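import Literature.MathematicalPhysics.QuantumFieldTheory.Balaban1983to89.B9Eq380CubeLetters
import Literature.MathematicalPhysics.QuantumFieldTheory.Balaban1983to89.B9Eq3132TentOperator
import Literature.MathematicalPhysics.QuantumFieldTheory.Balaban1983to89.B9Ineq369CurvatureSmallAtLettersY
import Literature.MathematicalPhysics.QuantumFieldTheory.Balaban1983to89.B9Eq3104CutoffCommutators

/-!
# `Balaban1983to89.B9Eq383CubeLetters` — T. Bałaban, *Propagators for lattice gauge theories in a background field*, Commun. Math. Phys. **99** (1985)
# 389–434 [Balaban1985BackgroundPropagators, "B9"], (3.82)–(3.83) p. 407 AT THE CUBE LETTERS OF SECT. C p. 409: THE AVERAGING-EXPANSION PIECE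
# `P₂ = Q*_□(U′U)a_□Q_□(U′U) − Q*_□(U)a_□Q_□(U)` IS SEMI-LOCAL AND `O(α₁)`-SMALL — POINTWISE (print's (3.83)) AND IN THE WEIGHT-ONE TRACE NORM
# (the `L²` operator bound that the Sect.-B step (3.84)–(3.86) consumes), with the cube sequence's averaging kernel bookkept (unit rows, small columns)

FRAMING (verbatim cell line):
statement-level skeleton of published theorems with citation tags; proofs where landed; nothing here is a claim about the Yang–Mills mass gap

Sources under audit (cell lit-balaban): [B9] (3.12)–(3.14) pp. 392–393 (`Q(U)`, `Q*(U)`), (3.26) p. 395 («Δ_a(U) = Δ(U) + D_UR(U)D*_U + Q*(U)aQ(U)»),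
(3.80)–(3.81) pp. 406–407, (3.82)–(3.86) p. 407, Sect. C p. 409 l. 1–5 («The operators constructed for this sequence, which we denote by G′_□(U),
C_□(U) …, G_□(U), satisfy all the inequalities of Theorems 3.1–3.3»); T. Bałaban, *Propagators and renormalization transformations for lattice gauge
theories. I*, Commun. Math. Phys. **95** (1984) 17–40 [Balaban1984PropagatorsI, "[3]"], (1.18) p. 20 (the straight-contour average); *… II*, Commun.
Math. Phys. **96** (1984) 223–250 [Balaban1984PropagatorsII, "[4]"], (2.3) p. 224, (2.16) p. 225, (2.18)–(2.20) p. 226; T. Bałaban, *Averaging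
operations for lattice gauge theories*, Commun. Math. Phys. **98** (1985) 17–51 [Balaban1985Averaging, "[5]"], (17)–(20) pp. 20–21 (`|X|² = tr X\*X`).
Pages read first-hand on the held text layer `paper:balaban1985-cmp99-background-propagators` p. 406–407 [PDF 18–19] (2026-08-28).

## WHAT IS PRINTED (verbatim up to notation)

p. 407 l. 1–12: «Combining the expansions (3.71), (3.76) and (3.80) we get Δ_a(U′U) = D*_{U′U}D_{U′U} + Δ′(U′U) + D_{U′U}R(U′U)D*_{U′U} + Q*(U′U)aQ(U′U) =
Δ_a(U) − V₃(A) + … + F₂*(A)aQ(U) + Q*(U)aF₂(A) + F₂*(A)aF₂(A) = Δ_a(U) − V₃(A) − P₁(A) − P₂(A). (3.82) … The operator P₂(A) is a sum of three terms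
obtained by the expansion of averaging operators. It is a semi-local operator in the sense that the value (P₂(A)A′)(b) at a bond b ∈ B_j(Λ_j) depends on
A, A′ restricted to j-blocks neighbouring the block containing the bond b. It satisfies the bound |(P₂(A)A′)(b)| ≦ O(1)α₁(Lʲη)⁻²|A′|, b ∈ B_j(Λ_j), (3.83)
with the norm |A′| restricted to the blocks defined above. … Let us denote the sum of these three operators by V(A). We can write (3.82) as
Δ_a(U′U) = Δ_a(U) − V(A) = (I − V(A)G(U))Δ_a(U). (3.84)»; p. 406 (3.80)–(3.81): «Q_j(U′U) = Q_j(U) + F_{2,j}(A) … |F_{2,j}(A; y, x)| ≦ O(1)α₁ … We have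
a similar expansion for Q*_j(U′U) … F*_{2,j}(A) satisfies (3.81). (… F*_{2,j}(A) is not the adjoint of F_{2,j}(A).)»

## WHAT THIS FILE PROVIDES (theorems only; 0 `def`, 0 `sorry`; the sequel of `B9Eq380CubeLetters` = (3.80)–(3.81) at the cube letters)

The letters are r05's cube letters of `B9CubeLettersBondOpsL0` — `Q_□(U) = QCubeY i q parB U`, `Q*_□(U) = QsCubeY …`, `a_□ = aCubeY i q` (diagonal, weight
`wCubeBond i q`) — at def-Y's taxicab transporters `parBY i`; `U′U` is `fun μ x => V μ x * U μ x`; «unitary-like» = `T4RelativeLadder.UnitaryLike`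
(`‖u‖ ≤ 1 ∧ ‖u⁻¹‖ ≤ 1`); `D := (d+2)(Lᵏ − 1)` is the averaging range of `B9Eq380CubeLetters.tdist_of_qKc_ne_zero_le`.
* §1 FROBENIUS BOOKKEEPING at the fibre `M_N(ℂ)` (dag-n06-j's `B9Eq3132TentOperator.fro`, the square root of the Hilbert–Schmidt sum, against the `L²`-OPERATOR
  norm of the factors): `fro_sq_eq_hs`, `fro_add_le` ∕ `fro_sum_le` ∕ `fro_sub_le`, `fro_smul_complex`, `fro_mul_left_le` ∕ `fro_mul_right_le` (`‖MX‖_F ≤ |M|‖X‖_F`),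
  `fro_R_le` (`‖R(V)X‖_F ≤ ‖X‖_F` at unitary-like `V`), ★ `fro_R_sub_R_le` (`‖R(V)X − R(W)X‖_F ≤ 2‖V − W‖·‖X‖_F`), ★ `fro_trLiftY_apply_le` ∕ ★ `fro_trLiftY_sub_apply_le`
  (fibrewise domination of a transported lift ∕ of a difference of transported lifts by the absolute kernel), ★★ `trIP_one_le_of_schur` ∕ `sqrt_trIP_one_le_of_schur`
  (SCHUR'S TEST in the weight-one trace norm `trIP 1` of `B9Thm311ReadingCoords`: fibrewise domination by a kernel with row sums `≤ r`, column sums `≤ c`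
  ⟹ `‖Ψ‖₁ ≤ √(rc)·‖Φ‖₁`).
* §2 THE AVERAGING KERNEL OF THE CUBE SEQUENCE: `qKc_nonneg`, ★ `sum_qKc_eq_one` ∕ `sum_abs_qKc_eq_one` (UNIT ROWS, [3] (1.18)), `eq_of_lvl_dir_src` (an index bond is
  determined by level, direction, source block), `qKc_le_count`, ★★ `sum_qKc_lvl_le` (ONE LEVEL GIVES A FINE BOND TOTAL WEIGHT `≤ L^{−JD}` — a sub-partition of unity,
  proved directly by counting contour parameters, without the layer analysis of n06-i's member file `B6IndexBondLayersKLevelV1`), ★★ `sum_qKc_col_le_two` ∕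
  `sum_abs_qsKc_le_two` (SMALL COLUMNS: `Σ_ι q_□(ι,f) ≤ 2`, geometric series over the levels), `wCubeBond_mul_plateau_le`, ★★ `sum_wCubeBond_mul_qKc_le`
  (THE WEIGHTED COLUMN SUM `Σ_ι w_□(ι)q_□(ι,f) ≤ 2b₁c_f²` — level `J` contributes `≤ b₁(c_f/Lᴶ)²`, print's `a_j(Lʲη)⁻²` summed over `j`), `aCubeY_apply` ∕ `norm_aCubeY_apply`.
* §3 ★★★ **(3.83) POINTWISE** `norm_QsaQCubeY_mul_sub_apply_le` (generic complete normed `ℂ`-algebra `𝔸` with `‖1‖ = 1`): for unitary-like `U, U′`, `‖U′(b′) − 1‖ ≤ ρ`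
  within `ℓ^∞`-distance `D` of the base point of every index bond `ι` whose stencil sees `b`, and the LEVEL-WEIGHTED amplitude bound `w_□(ι)·‖A(f)‖ ≤ P` on the
  double support (p38's currency of `B9Eq3104CommutatorSizesAvg`; print's «|A′| restricted to the neighbouring blocks» with the factor `(Lʲη)⁻²` inside `w_□`):
  `‖(P₂A)(b)‖ ≤ 4Dρ(1 + Dρ)·P·Σ_ι |q*_□(b, ι)|`; with the column sum discharged `…_le'` (`≤ 8Dρ(1 + Dρ)P`), the global-smallness form `…_of_forall`, the
  background-`1` face `norm_QsaQCubeY_sub_one_apply_le_of_forall` (the cube road of Cor. 3.6); the ingredients `mul_norm_QCubeY_apply_le` (one average), `mul_norm_F2_apply_le`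
  (one expanded average), `apply_sub_apply_eq_three_terms` (the (3.82) bookkeeping `S₁X₁ − S₀X₀ = (S₁ − S₀)X₀ + S₀(X₁ − X₀) + (S₁ − S₀)(X₁ − X₀)`).
* §4 ★★★ **(3.83) IN `L²`** `sqrt_trIP_QsaQCubeY_mul_sub_le` (`𝔸 = M_N(ℂ)`, `L²`-operator norm on the fibre): for unitary-valued `U, U′` small as above around EVERY
  base point, `‖P₂C‖₁ ≤ 8·b₁c_f²·Dρ(1 + Dρ)·‖C‖₁` — Schur's test on the symmetric semi-local kernel `c₀·Q_□ᵀa_□Q_□` (★★ `fro_QsaQCubeY_mul_sub_apply_le`: the fibrewise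
  domination); THE STATEMENT IS EXACTLY THE INPUT `hP` OF ym-inputs-p02's `B9Eq382CubeLetters.hQ_of_normBound_reversed` (p621985 ✓) at `parB := parBY i`, `U₀ := U`,
  `U′ := U′U`, `aP := 8b₁c_f²Dρ(1 + Dρ)` — the `P₂`-piece of the (ii)-input of `B9Thm311CubeLettersGCoercive` ∕ `B9Eq382CubeLetters.deltaACubeY_posDefTr_of_pieces`;
  `…_of_forall`, `sqrt_trIP_QsaQCubeY_sub_one_le_of_forall` (background `1`); by-products ★ `sqrt_trIP_QCubeY_le` ∕ `sqrt_trIP_QsCubeY_le` (`‖Q_□(U)‖, ‖Q*_□(U)‖ ≤ √2`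
  in `‖·‖₁`), ★ `sqrt_trIP_F2_le` (`‖F₂‖ ≤ 2Dρ√2`), and the fibrewise `fro_QCubeY_apply_le` ∕ `fro_QsCubeY_apply_le` ∕ `fro_F2_apply_le` ∕ `fro_F2s_apply_le` ∕ `fro_aCubeY_apply`.

v1.1 (same seat, append-only): every range-dependent statement of §3–§4 has a MASTER `…_ofRange` with the averaging range a PARAMETER `Da`
(`hDa : q_□(ι,b) ≠ 0 ⟹ |embIter j(ι) ι₋ − b₋|₁ ≤ Da` — `B9Eq380CubeLetters.norm_QCubeY_mul_sub_apply_le`'s binder; the smallness of `U′ − 1` is then asked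
only within `ℓ^∞`-distance `Da` of the base points): `mul_norm_F2_apply_le_ofRange`, `norm_QsaQCubeY_mul_sub_apply_le_ofRange`, `fro_F2_apply_le_ofRange`,
`fro_F2s_apply_le_ofRange`, `fro_QsaQCubeY_mul_sub_apply_le_ofRange`, `sqrt_trIP_QsaQCubeY_mul_sub_le_ofRange`, `sqrt_trIP_F2_le_ofRange` — ON THE CUBE ROAD
(Cor. 3.6 p. 408: `U′ = U^u` is small on the enlarged cube only) the consumer takes the cube's own level-sharp range (`B9Eq380CubeLetters.tdist_of_qKc_ne_zero`,
`(d+2)(L^{j(ι)} − 1)` bounded by the cube sequence's top level) instead of the member-uniform `D = (d+2)(Lᵏ − 1)` of the v1 statements, which are now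
the `Da := D` corollaries (statements byte-identical to v1).

## HONEST SCOPE ∕ DECLARED READINGS

* Finite lattice algebra, Cauchy–Schwarz and one counting argument; NOTHING of [B9]'s analysis ((3.78), [5] (143)) is asserted or used: the smallness
  `‖U′(b) − 1‖ ≤ ρ` is a HYPOTHESIS (on the cube road it is the bondwise face of p21's `Small337OnCube`, `ρ = e^{α₁L^{−j}} − 1`, w1's `norm_fluct_sub_one_le`),
  and print's `O(1)α₁` is here `4Dρ(1 + Dρ)` (pointwise, times the column sum `Σ_ι|q*_□(b,ι)| ≤ 2`) ∕ `8b₁c_f²Dρ(1 + Dρ)` (`L²`), with `D`, `b₁`, `c_f` explicit.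
* READING of (3.83): print's sup bound «O(1)α₁(Lʲη)⁻²|A′| restricted to neighbouring blocks» is rendered in the LEVEL-WEIGHTED currency of the tree's [B9]
  files (`w_□(ι)·‖A(f)‖ ≤ P` on the double support — the weight `w_□` = print's `a_j(Lʲη)⁻²` in lattice units carries the factor `(Lʲη)⁻²`); the `L²`
  statement of §4 is the form in which (3.83) enters (3.85) («V(A)G(U) is a small operator»), not a separately printed display.  `P₂` is written as the
  DIFFERENCE `Q*_□(U′U)a_□Q_□(U′U) − Q*_□(U)a_□Q_□(U)` (= print's `F₂*aQ(U) + Q*(U)aF₂ + F₂*aF₂` by the bookkeeping `apply_sub_apply_eq_three_terms`; print's sign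
  convention `Δ_a(U′U) = Δ_a(U) − … − P₂(A)` is p02's `B9Eq382CubeLetters.QsaQ_sub_regroup`, consumed through `hQ_of_normBound_reversed`).
* `U, U′` unitary-LIKE (norm `≤ 1` with inverse) suffices; the transporters are def-Y's taxicab contours `parBY` (the letters of record of the N06 knit).
* Count-neutral; NOT a node discharge; no summit ∕ sub-problem statement is proved; nothing continuum ∕ mass gap ∕ Clay.  Cell `lit-balaban`, seat
  `lit-balaban-r05` gen 82 (explicit-unit), 2026-08-28; sub-row G-B9-LETTERS (sequel of M5.1b-Q; consumer ym-inputs-p02 M5.1b-G ∕ (ii)); `--supports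
  stmt-QuantumFields-19200` as helper.  v1 NEW file p622743; v1.1 append-only (7 `_ofRange` masters, v1 proofs rerouted through them, statements unchanged).  Net new unproved facts: 0.
-/


namespace Literature.MathematicalPhysics.QuantumFieldTheory.Balaban1983to89.B9Eq383CubeLetters

open LatticeFieldCalculus
open Node00
open Literature.MathematicalPhysics.QuantumFieldTheory.Balaban1983to89.B9Eq39Adjoint (R R_def R_sub R_smul)
open Literature.MathematicalPhysics.QuantumFieldTheory.Balaban1983to89.T4RelativeLadder (UnitaryLike norm_inv_sub_inv_le)
open Literature.MathematicalPhysics.QuantumFieldTheory.Balaban1983to89.B9Thm311ReadingCoords (trIP realify311 norm_sq_realify311)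
open Literature.MathematicalPhysics.QuantumFieldTheory.Balaban1983to89.B9Eq3132TentOperator (fro fro_nonneg fro_sq fro_eq_norm fro_smul trIP_one_eq_sum_fro_sq)
open Literature.MathematicalPhysics.QuantumFieldTheory.Balaban1983to89.B9Ineq369CurvatureSmallAtLettersY (hs_mul_left_le hs_mul_right_le hs_R_le hs_nonneg)
open scoped Matrix

noncomputable section

/-! ## §1 The Frobenius size `‖X‖_F` of one fibre matrix as a seminorm dominated by the operator norm of the factors -/

section Fro

open scoped Matrix.Norms.L2Operator

variable {N : ℕ}

/-- `‖X‖_F² = Σ_{ab} |X_{ab}|²` (the Hilbert–Schmidt sum). [cite: Balaban1985Averaging, (17) p.20 (‖X‖² = tr X\*X), bookkeeping] -/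
theorem fro_sq_eq_hs (X : Matrix (Fin N) (Fin N) ℂ) : fro X ^ 2 = ∑ a, ∑ b, ‖X a b‖ ^ 2 := by
  rw [fro_sq, MatrixNorms.sum_norm_sq_eq_re_trace]

/-- `‖X‖_F = √(Σ_{ab} |X_{ab}|²)`. [cite: Balaban1985Averaging, (17) p.20, bookkeeping] -/
theorem fro_eq_sqrt_hs (X : Matrix (Fin N) (Fin N) ℂ) : fro X = Real.sqrt (∑ a, ∑ b, ‖X a b‖ ^ 2) := by
  rw [← fro_sq_eq_hs, Real.sqrt_sq (fro_nonneg X)]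

/-- the Frobenius size is subadditive. [cite: Balaban1985BackgroundPropagators, p.393 (scalar products), folklore] -/
theorem fro_add_le (X Y : Matrix (Fin N) (Fin N) ℂ) : fro (X + Y) ≤ fro X + fro Y := by
  rw [fro_eq_norm, fro_eq_norm, fro_eq_norm]
  have h : (fun _ : Unit => X + Y) = (fun _ : Unit => X) + (fun _ : Unit => Y) := rfl
  rw [h, map_add]
  exact norm_add_le _ _

/-- the Frobenius size of a finite sum is at most the sum of the sizes. [cite: Balaban1985BackgroundPropagators, p.393, folklore] -/
theorem fro_sum_le {ι : Type} (s : Finset ι) (Z : ι → Matrix (Fin N) (Fin N) ℂ) : fro (∑ x ∈ s, Z x) ≤ ∑ x ∈ s, fro (Z x) := by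
  classical
  induction s using Finset.induction_on with
  | empty => simp [fro]
  | insert a s ha ih =>
    rw [Finset.sum_insert ha, Finset.sum_insert ha]
    exact (fro_add_le _ _).trans (by linarith)

/-- `‖X − Y‖_F ≤ ‖X‖_F + ‖Y‖_F`. [cite: Balaban1985BackgroundPropagators, p.393, folklore] -/
theorem fro_sub_le (X Y : Matrix (Fin N) (Fin N) ℂ) : fro (X - Y) ≤ fro X + fro Y := by
  have h := fro_add_le X ((-1 : ℝ) • Y)
  rw [fro_smul, abs_neg, abs_one, one_mul] at h
  simpa [sub_eq_add_neg] using h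

/-- `‖c • X‖_F = |c|·‖X‖_F` for complex scalars. [cite: Balaban1985Averaging, (17) p.20, bookkeeping] -/
theorem fro_smul_complex (c : ℂ) (X : Matrix (Fin N) (Fin N) ℂ) : fro (c • X) = ‖c‖ * fro X := by
  rw [fro_eq_sqrt_hs, fro_eq_sqrt_hs, B9Ineq369CurvatureSmallAtLettersY.hs_smul, Real.sqrt_mul (sq_nonneg _), Real.sqrt_sq (norm_nonneg _)]

/-- left multiplication costs the OPERATOR norm: `‖MX‖_F ≤ |M|·‖X‖_F`. [cite: Balaban1985Averaging, (20) p.21] -/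
theorem fro_mul_left_le (M X : Matrix (Fin N) (Fin N) ℂ) : fro (M * X) ≤ ‖M‖ * fro X := by
  rw [fro_eq_sqrt_hs, fro_eq_sqrt_hs, ← Real.sqrt_sq (norm_nonneg M), ← Real.sqrt_mul (sq_nonneg _)]
  exact Real.sqrt_le_sqrt (hs_mul_left_le M X)

/-- right multiplication: `‖XM‖_F ≤ |M|·‖X‖_F`. [cite: Balaban1985Averaging, (20) p.21] -/
theorem fro_mul_right_le (X M : Matrix (Fin N) (Fin N) ℂ) : fro (X * M) ≤ ‖M‖ * fro X := by
  rw [fro_eq_sqrt_hs, fro_eq_sqrt_hs, ← Real.sqrt_sq (norm_nonneg M), ← Real.sqrt_mul (sq_nonneg _)]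
  exact Real.sqrt_le_sqrt (hs_mul_right_le X M)

/-- the adjoint action by a unitary-like unit (`|V|, |V⁻¹| ≤ 1`) does not increase the Frobenius size: `‖R(V)X‖_F ≤ ‖X‖_F`.
[cite: Balaban1985BackgroundPropagators, (3.3) p.390 (R(U)X = UXU⁻¹), (3.35) p.396] -/
theorem fro_R_le {V : (Matrix (Fin N) (Fin N) ℂ)ˣ} (hV : UnitaryLike V) (X : Matrix (Fin N) (Fin N) ℂ) : fro (R V X) ≤ fro X := by
  rw [fro_eq_sqrt_hs, fro_eq_sqrt_hs]
  exact Real.sqrt_le_sqrt (hs_R_le hV X)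

/-- ★ **THE ADJOINT ACTION IS LIPSCHITZ IN THE UNIT, IN FROBENIUS SIZE**: `‖R(V)X − R(W)X‖_F ≤ 2‖V − W‖·‖X‖_F` for unitary-like `V, W`
(`R(V)X − R(W)X = (V − W)XV⁻¹ + WX(V⁻¹ − W⁻¹)`). [cite: Balaban1985BackgroundPropagators, (3.3) p.390, (3.80)–(3.81) p.406, folklore] -/
theorem fro_R_sub_R_le {V W : (Matrix (Fin N) (Fin N) ℂ)ˣ} (hV : UnitaryLike V) (hW : UnitaryLike W) (X : Matrix (Fin N) (Fin N) ℂ) :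
    fro (R V X - R W X) ≤ 2 * ‖(V : Matrix (Fin N) (Fin N) ℂ) - (W : Matrix (Fin N) (Fin N) ℂ)‖ * fro X := by
  have hsplit : R V X - R W X =
      ((V : Matrix (Fin N) (Fin N) ℂ) - (W : Matrix (Fin N) (Fin N) ℂ)) * X * ((V⁻¹ : (Matrix (Fin N) (Fin N) ℂ)ˣ) : Matrix (Fin N) (Fin N) ℂ) +
        (W : Matrix (Fin N) (Fin N) ℂ) * X * (((V⁻¹ : (Matrix (Fin N) (Fin N) ℂ)ˣ) : Matrix (Fin N) (Fin N) ℂ) -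
          ((W⁻¹ : (Matrix (Fin N) (Fin N) ℂ)ˣ) : Matrix (Fin N) (Fin N) ℂ)) := by
    simp only [R_def, sub_mul, mul_sub]; abel
  rw [hsplit]
  have h1 : fro (((V : Matrix (Fin N) (Fin N) ℂ) - (W : Matrix (Fin N) (Fin N) ℂ)) * X * ((V⁻¹ : (Matrix (Fin N) (Fin N) ℂ)ˣ) : Matrix (Fin N) (Fin N) ℂ)) ≤
      ‖(V : Matrix (Fin N) (Fin N) ℂ) - (W : Matrix (Fin N) (Fin N) ℂ)‖ * fro X :=
    calc _ ≤ ‖((V⁻¹ : (Matrix (Fin N) (Fin N) ℂ)ˣ) : Matrix (Fin N) (Fin N) ℂ)‖ * fro (((V : Matrix (Fin N) (Fin N) ℂ) - (W : Matrix (Fin N) (Fin N) ℂ)) * X) := fro_mul_right_le _ _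
      _ ≤ 1 * (‖(V : Matrix (Fin N) (Fin N) ℂ) - (W : Matrix (Fin N) (Fin N) ℂ)‖ * fro X) :=
          mul_le_mul hV.2 (fro_mul_left_le _ _) (fro_nonneg _) zero_le_one
      _ = _ := one_mul _
  have h2 : fro ((W : Matrix (Fin N) (Fin N) ℂ) * X * (((V⁻¹ : (Matrix (Fin N) (Fin N) ℂ)ˣ) : Matrix (Fin N) (Fin N) ℂ) -
      ((W⁻¹ : (Matrix (Fin N) (Fin N) ℂ)ˣ) : Matrix (Fin N) (Fin N) ℂ))) ≤ ‖(V : Matrix (Fin N) (Fin N) ℂ) - (W : Matrix (Fin N) (Fin N) ℂ)‖ * fro X :=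
    calc _ ≤ ‖((V⁻¹ : (Matrix (Fin N) (Fin N) ℂ)ˣ) : Matrix (Fin N) (Fin N) ℂ) - ((W⁻¹ : (Matrix (Fin N) (Fin N) ℂ)ˣ) : Matrix (Fin N) (Fin N) ℂ)‖ *
          fro ((W : Matrix (Fin N) (Fin N) ℂ) * X) := fro_mul_right_le _ _
      _ ≤ ‖(V : Matrix (Fin N) (Fin N) ℂ) - (W : Matrix (Fin N) (Fin N) ℂ)‖ * (‖(W : Matrix (Fin N) (Fin N) ℂ)‖ * fro X) :=
          mul_le_mul (norm_inv_sub_inv_le hV hW) (fro_mul_left_le _ _) (fro_nonneg _) (norm_nonneg _)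
      _ ≤ ‖(V : Matrix (Fin N) (Fin N) ℂ) - (W : Matrix (Fin N) (Fin N) ℂ)‖ * (1 * fro X) :=
          mul_le_mul_of_nonneg_left (mul_le_mul_of_nonneg_right hW.1 (fro_nonneg _)) (norm_nonneg _)
      _ = _ := by rw [one_mul]
  linarith [fro_add_le (((V : Matrix (Fin N) (Fin N) ℂ) - (W : Matrix (Fin N) (Fin N) ℂ)) * X * ((V⁻¹ : (Matrix (Fin N) (Fin N) ℂ)ˣ) : Matrix (Fin N) (Fin N) ℂ))
    ((W : Matrix (Fin N) (Fin N) ℂ) * X * (((V⁻¹ : (Matrix (Fin N) (Fin N) ℂ)ˣ) : Matrix (Fin N) (Fin N) ℂ) -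
      ((W⁻¹ : (Matrix (Fin N) (Fin N) ℂ)ˣ) : Matrix (Fin N) (Fin N) ℂ)))]

variable {X Y : Type} [Fintype X] [Fintype Y]

omit [Fintype Y] in
/-- ★ **FROBENIUS ROW DOMINATION OF A TRANSPORTED LIFT**: at unitary-like transporters on the support of the row,
`‖(M♯_T Λ)(y)‖_F ≤ Σ_x |M(y,x)|·‖Λ(x)‖_F`. [cite: Balaban1985BackgroundPropagators, (3.12)–(3.14) pp.392–393, (3.28) p.395, bookkeeping] -/
theorem fro_trLiftY_apply_le (M : Matrix Y X ℝ) {T : Y → X → (Matrix (Fin N) (Fin N) ℂ)ˣ} (Λ : X → Matrix (Fin N) (Fin N) ℂ) (y : Y)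
    (hT : ∀ x, M y x ≠ 0 → UnitaryLike (T y x)) :
    fro (trLiftY M T Λ y) ≤ ∑ x, |M y x| * fro (Λ x) := by
  rw [trLiftY_apply]
  refine (fro_sum_le _ _).trans (Finset.sum_le_sum fun x _ => ?_)
  by_cases hx : M y x = 0
  · simp [hx, fro]
  · rw [fro_smul_complex, Complex.norm_real, Real.norm_eq_abs]
    exact mul_le_mul_of_nonneg_left (fro_R_le (hT x hx) _) (abs_nonneg _)

omit [Fintype Y] in
/-- ★ **FROBENIUS ROW DOMINATION OF A DIFFERENCE OF TRANSPORTED LIFTS** (the transported lift is Lipschitz in its transporters): if on the support of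
the row the transporters `T(y,x), T′(y,x)` are unitary-like and `‖T(y,x) − T′(y,x)‖ ≤ τ(x)`, then
`‖(M♯_T Λ − M♯_{T′} Λ)(y)‖_F ≤ Σ_x |M(y,x)|·2τ(x)·‖Λ(x)‖_F`. [cite: Balaban1985BackgroundPropagators, (3.80)–(3.81) p.406, (3.12) p.392] -/
theorem fro_trLiftY_sub_apply_le (M : Matrix Y X ℝ) (T T' : Y → X → (Matrix (Fin N) (Fin N) ℂ)ˣ) (Λ : X → Matrix (Fin N) (Fin N) ℂ) (y : Y)
    {τ : X → ℝ} (hT : ∀ x, M y x ≠ 0 → UnitaryLike (T y x)) (hT' : ∀ x, M y x ≠ 0 → UnitaryLike (T' y x))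
    (hτ : ∀ x, M y x ≠ 0 → ‖(T y x : Matrix (Fin N) (Fin N) ℂ) - (T' y x : Matrix (Fin N) (Fin N) ℂ)‖ ≤ τ x) :
    fro ((trLiftY M T Λ - trLiftY M T' Λ) y) ≤ ∑ x, |M y x| * (2 * τ x * fro (Λ x)) := by
  rw [B9Eq380CubeLetters.trLiftY_sub_trLiftY_apply]
  refine (fro_sum_le _ _).trans (Finset.sum_le_sum fun x _ => ?_)
  by_cases hx : M y x = 0
  · simp [hx, fro]
  · rw [fro_smul_complex, Complex.norm_real, Real.norm_eq_abs]
    refine mul_le_mul_of_nonneg_left ?_ (abs_nonneg _)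
    calc fro (R (T y x) (Λ x) - R (T' y x) (Λ x)) ≤ 2 * ‖(T y x : Matrix (Fin N) (Fin N) ℂ) - (T' y x : Matrix (Fin N) (Fin N) ℂ)‖ * fro (Λ x) :=
          fro_R_sub_R_le (hT x hx) (hT' x hx) _
      _ ≤ 2 * τ x * fro (Λ x) := by gcongr; exacts [fro_nonneg _, hτ x hx]

/-- ★★ **SCHUR'S TEST IN THE TRACE NORM**: a map `Φ ↦ Ψ` dominated fibrewise in Frobenius size by a non-negative kernel `K` with row sums `≤ r` and
column sums `≤ c` satisfies `‖Ψ‖₁² ≤ r·c·‖Φ‖₁²` (`‖·‖₁² = trIP 1`, the weight-one trace norm of the N06 knit).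
[cite: Balaban1985BackgroundPropagators, p.393 (scalar products), (3.83) p.407; folklore (Schur test)] -/
theorem trIP_one_le_of_schur (K : Y → X → ℝ) (hK : ∀ y x, 0 ≤ K y x) {r c : ℝ} (hr0 : 0 ≤ r) (hr : ∀ y, ∑ x, K y x ≤ r)
    (hc : ∀ x, ∑ y, K y x ≤ c) (Φ : X → Matrix (Fin N) (Fin N) ℂ) (Ψ : Y → Matrix (Fin N) (Fin N) ℂ)
    (hdom : ∀ y, fro (Ψ y) ≤ ∑ x, K y x * fro (Φ x)) :
    trIP (fun _ => (1 : ℝ)) Ψ Ψ ≤ r * c * trIP (fun _ => (1 : ℝ)) Φ Φ := by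
  rw [trIP_one_eq_sum_fro_sq, trIP_one_eq_sum_fro_sq]
  -- fibrewise: `‖Ψ y‖² ≤ (Σ_x K)·(Σ_x K‖Φ x‖²) ≤ r·Σ_x K(y,x)‖Φ x‖²` (Cauchy–Schwarz)
  have hy : ∀ y, fro (Ψ y) ^ 2 ≤ r * ∑ x, K y x * fro (Φ x) ^ 2 := by
    intro y
    have hcs := Finset.sum_mul_sq_le_sq_mul_sq Finset.univ (fun x => Real.sqrt (K y x)) (fun x => Real.sqrt (K y x) * fro (Φ x))
    have e1 : ∀ x, Real.sqrt (K y x) * (Real.sqrt (K y x) * fro (Φ x)) = K y x * fro (Φ x) := fun x => by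
      rw [← mul_assoc, Real.mul_self_sqrt (hK y x)]
    have e2 : ∀ x, Real.sqrt (K y x) ^ 2 = K y x := fun x => Real.sq_sqrt (hK y x)
    have e3 : ∀ x, (Real.sqrt (K y x) * fro (Φ x)) ^ 2 = K y x * fro (Φ x) ^ 2 := fun x => by rw [mul_pow, Real.sq_sqrt (hK y x)]
    simp only [e1, e2, e3] at hcs
    have hnn : 0 ≤ ∑ x, K y x * fro (Φ x) ^ 2 := Finset.sum_nonneg fun x _ => mul_nonneg (hK y x) (sq_nonneg _)
    calc fro (Ψ y) ^ 2 ≤ (∑ x, K y x * fro (Φ x)) ^ 2 := pow_le_pow_left₀ (fro_nonneg _) (hdom y) 2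
      _ ≤ (∑ x, K y x) * ∑ x, K y x * fro (Φ x) ^ 2 := hcs
      _ ≤ r * ∑ x, K y x * fro (Φ x) ^ 2 := mul_le_mul_of_nonneg_right (hr y) hnn
  -- summed over `y`, exchange, column sums
  calc ∑ y, fro (Ψ y) ^ 2 ≤ ∑ y, r * ∑ x, K y x * fro (Φ x) ^ 2 := Finset.sum_le_sum fun y _ => hy y
    _ = r * ∑ x, (∑ y, K y x) * fro (Φ x) ^ 2 := by
        rw [← Finset.mul_sum, Finset.sum_comm]
        congr 1
        exact Finset.sum_congr rfl fun x _ => by rw [Finset.sum_mul]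
    _ ≤ r * ∑ x, c * fro (Φ x) ^ 2 := by
        refine mul_le_mul_of_nonneg_left (Finset.sum_le_sum fun x _ => ?_) hr0
        exact mul_le_mul_of_nonneg_right (hc x) (sq_nonneg _)
    _ = r * c * ∑ x, fro (Φ x) ^ 2 := by rw [← Finset.mul_sum, mul_assoc]

/-- ★★ **SCHUR'S TEST, NORM FORM**: under the same domination, `‖Ψ‖₁ ≤ √(r·c)·‖Φ‖₁` — the `(a, b) = (√(rc), 0)` instance of the `L²` operator-bound
shape `∀ C, √⟨RC, RC⟩ ≤ a√⟨C, C⟩ + b√⟨C, T₀C⟩` of `B9Thm311CubeLettersGCoercive.relBound_of_normBound`. [cite: Balaban1985BackgroundPropagators, (3.83)–(3.85) p.407; folklore (Schur test)] -/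
theorem sqrt_trIP_one_le_of_schur (K : Y → X → ℝ) (hK : ∀ y x, 0 ≤ K y x) {r c : ℝ} (hr0 : 0 ≤ r) (hr : ∀ y, ∑ x, K y x ≤ r)
    (hc : ∀ x, ∑ y, K y x ≤ c) (Φ : X → Matrix (Fin N) (Fin N) ℂ) (Ψ : Y → Matrix (Fin N) (Fin N) ℂ)
    (hdom : ∀ y, fro (Ψ y) ≤ ∑ x, K y x * fro (Φ x)) :
    Real.sqrt (trIP (fun _ => (1 : ℝ)) Ψ Ψ) ≤ Real.sqrt (r * c) * Real.sqrt (trIP (fun _ => (1 : ℝ)) Φ Φ) := by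
  rw [← Real.sqrt_mul' _ (by rw [trIP_one_eq_sum_fro_sq]; exact Finset.sum_nonneg fun x _ => sq_nonneg _)]
  exact Real.sqrt_le_sqrt (trIP_one_le_of_schur K hK hr0 hr hc Φ Ψ hdom)

end Fro

/-! ## §2 The averaging kernel of the cube sequence: unit rows, small columns, the diagonal weight -/

section Kernel

open Literature.MathematicalPhysics.QuantumFieldTheory.Balaban1983to89.B6KLevelCensusIndexV1 (KIdx)
open Literature.MathematicalPhysics.QuantumFieldTheory.Balaban1983to89.B6Cover236MultiLevelBlocks (cubes)
open Literature.MathematicalPhysics.QuantumFieldTheory.Balaban1983to89.B6GlobalChartV1 (PV)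
open Literature.MathematicalPhysics.QuantumFieldTheory.Balaban1983to89.B5Eq118OneStroke (iterBlock iterBlockOf mem_iterBlock)
open Literature.MathematicalPhysics.QuantumFieldTheory.Balaban1983to89.B6AvgWeightsKLevelV1 (backSite runSite_eq_iff cQ_mul_pow)
open Literature.MathematicalPhysics.QuantumFieldTheory.Balaban1983to89.B6Ineq2142KLevelV1 (cQ cQ_pos cQ_mul_card)
open Literature.MathematicalPhysics.QuantumFieldTheory.Balaban1983to89.B9CubeLettersOpsL0 (cubeFamY)
open Literature.MathematicalPhysics.QuantumFieldTheory.Balaban1983to89.B9CubeLettersBondOpsL0 (IBondCubeY qKc qsKc aKc aCubeY)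
open Literature.MathematicalPhysics.QuantumFieldTheory.Balaban1983to89.B9CubeBondWeights (domCube wCubeBond wCubeBond_pos wCubeBond_band)
open Literature.MathematicalPhysics.QuantumFieldTheory.Balaban1983to89.B9CubeLettersCovarianceL0 (qsKc_eq_transpose aKc_eq_diagonal)
open Literature.MathematicalPhysics.QuantumFieldTheory.Balaban1983to89.B9CubeBondRowAgreementNearH (qKc_apply')

variable {d ℓ : ℕ} {hd : 1 ≤ d + 1} {hL : Odd (ℓ + 1) ∧ 1 < ℓ + 1} {b₀ b₁ : ℝ}
variable (i : KIdx d ℓ hd hL b₀ b₁) (q : ↥(cubes (toKT i).D.toDomains))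

/-- `q_□ ≥ 0`. [cite: Balaban1984PropagatorsI, (1.18) p.20; Balaban1985BackgroundPropagators, (3.12) p.392, p.409 l.3–5] -/
theorem qKc_nonneg (ι : IBondCubeY i q) (f : FBondY i) : 0 ≤ qKc i q ι f := by
  rw [qKc_apply']; exact B6Ineq2142KLevelV1L0.qwt_nonneg _ _ _ _ _

/-- **UNIT ROW SUMS**: `Σ_f q_□(ι, f) = 1` — each `Q_j` is an average over `L^{j(D+1)}` pairs (block site, contour bond).
[cite: Balaban1984PropagatorsI, (1.18) p.20; Balaban1985BackgroundPropagators, (3.12)–(3.14) pp.392–393, p.409 l.3–5] -/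
theorem sum_qKc_eq_one (ι : IBondCubeY i q) : ∑ f, qKc i q ι f = 1 := by
  classical
  simp_rw [qKc_apply', B6Ineq2142KLevelV1L0.qwt_eq_sum]
  rw [← Finset.mul_sum, Finset.sum_comm]
  have hinner : ∀ x ∈ iterBlock (ι.1.1 : ℕ) ι.1.2.src,
      ∑ f : FBondY i, ∑ t ∈ Finset.range ((ℓ + 1) ^ (ι.1.1 : ℕ)), (if runBond x ι.1.2.dir t = f then (1 : ℝ) else 0) =
        ((ℓ + 1) ^ (ι.1.1 : ℕ) : ℕ) := by
    intro x _
    rw [Finset.sum_comm]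
    have : ∀ t ∈ Finset.range ((ℓ + 1) ^ (ι.1.1 : ℕ)), ∑ f : FBondY i, (if runBond x ι.1.2.dir t = f then (1 : ℝ) else 0) = 1 := by
      intro t _
      rw [Finset.sum_ite_eq]; simp
    rw [Finset.sum_congr rfl this, Finset.sum_const, Finset.card_range, nsmul_eq_mul, mul_one]
  rw [Finset.sum_congr rfl hinner, Finset.sum_const, nsmul_eq_mul,
    B5Eq118OneStroke.card_iterBlock _ (B6Ineq2142KLevelV1L0.lvl_le_mK i.hN (cubeFamY i q) i.hk ι) _]
  exact cQ_mul_card (d := d) (ℓ := ℓ) (ι.1.1 : ℕ)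

/-- `Σ_f |q_□(ι, f)| = 1`. [cite: Balaban1984PropagatorsI, (1.18) p.20; Balaban1985BackgroundPropagators, (3.12) p.392] -/
theorem sum_abs_qKc_eq_one (ι : IBondCubeY i q) : ∑ f, |qKc i q ι f| = 1 := by
  rw [← sum_qKc_eq_one i q ι]
  exact Finset.sum_congr rfl fun f _ => abs_of_nonneg (qKc_nonneg i q ι f)

/-- **TWO INDEX BONDS OF THE CUBE SEQUENCE WITH THE SAME LEVEL, DIRECTION AND SOURCE BLOCK COINCIDE** (read off a common fine site of the source
block; the cube twin of n06-i's `B6IndexBondLayersKLevelV1.eq_of_lvl_dir_src`). [cite: Balaban1984PropagatorsII, (2.3) p.224, bookkeeping] -/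
theorem eq_of_lvl_dir_src {ι ι₂ : IBondCubeY i q} (hl : (ι₂.1.1 : ℕ) = (ι.1.1 : ℕ)) (hdir : ι₂.1.2.dir = ι.1.2.dir)
    {x : Site (PV d ℓ i.m i.K hd hL) 0} (hx : iterBlockOf (ι.1.1 : ℕ) x = ι.1.2.src) (hx₂ : iterBlockOf (ι₂.1.1 : ℕ) x = ι₂.1.2.src) :
    ι₂ = ι := by
  rcases ι with ⟨⟨j, ⟨s, μ⟩⟩, hb⟩
  rcases ι₂ with ⟨⟨j₂, ⟨s₂, μ₂⟩⟩, hb₂⟩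
  have hj : j₂ = j := Fin.ext hl
  subst hj
  have hμ : μ₂ = μ := hdir
  subst hμ
  have hs : s = s₂ := hx.symm.trans hx₂
  subst hs
  rfl

open Classical in
/-- **THE WEIGHT AS A COUNT OVER THE CONTOUR PARAMETER, BOUNDED**: `q_□(ι, f) ≤ L^{−j(D+1)}·#{t < Lʲ : dir ι = dir f ∧ f₋ − te_μ ∈ Bʲ(ι₋)}` (each `t` has the
single candidate start `f₋ − te_μ`). [cite: Balaban1984PropagatorsI, (1.18) p.20] -/
theorem qKc_le_count (ι : IBondCubeY i q) (f : FBondY i) {J : ℕ} (hl : (ι.1.1 : ℕ) = J) :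
    qKc i q ι f ≤ cQ (d := d) (ℓ := ℓ) J * ∑ t ∈ Finset.range ((ℓ + 1) ^ J),
      (if ι.1.2.dir = f.dir ∧ iterBlockOf (ι.1.1 : ℕ) (backSite f.src f.dir t) = ι.1.2.src then (1 : ℝ) else 0) := by
  subst hl
  rw [qKc_apply', B6Ineq2142KLevelV1L0.qwt_eq_sum, Finset.sum_comm]
  refine mul_le_mul_of_nonneg_left (Finset.sum_le_sum fun t _ => ?_) (cQ_pos _).le
  -- a start `x ∈ Bʲ(ι₋)` with `runBond x (dir ι) t = f` forces `dir ι = dir f`, `x = f₋ − te_μ`, hence the block condition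
  have hstart : ∀ x ∈ iterBlock (ι.1.1 : ℕ) ι.1.2.src, runBond x ι.1.2.dir t = f →
      x = backSite f.src f.dir t ∧ (ι.1.2.dir = f.dir ∧ iterBlockOf (ι.1.1 : ℕ) (backSite f.src f.dir t) = ι.1.2.src) := by
    intro x hx h
    have hdir : ι.1.2.dir = f.dir := by rw [← h]; rfl
    have hsrc : runSite x ι.1.2.dir t = f.src := by rw [← h]; rfl
    have hxe : x = backSite f.src f.dir t := by rw [← hdir]; exact (runSite_eq_iff _ _ _ _).1 hsrc
    exact ⟨hxe, hdir, by rw [← hxe]; exact (mem_iterBlock _ _ _).1 hx⟩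
  by_cases hc : ι.1.2.dir = f.dir ∧ iterBlockOf (ι.1.1 : ℕ) (backSite f.src f.dir t) = ι.1.2.src
  · rw [if_pos hc, Finset.sum_boole]
    have : ((iterBlock (ι.1.1 : ℕ) ι.1.2.src).filter fun x => runBond x ι.1.2.dir t = f).card ≤ 1 := by
      refine Finset.card_le_one.2 fun a ha b hb => ?_
      rw [Finset.mem_filter] at ha hb
      rw [(hstart a ha.1 ha.2).1, (hstart b hb.1 hb.2).1]
    exact_mod_cast this
  · rw [if_neg hc]
    refine (Finset.sum_eq_zero fun x hx => ?_).le
    rw [if_neg]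
    exact fun h => hc (hstart x hx h).2

open Classical in
/-- ★ **THE TOTAL WEIGHT A FINE BOND RECEIVES FROM ONE LEVEL IS AT MOST THE PLATEAU**: `Σ_{ι : j(ι) = J} q_□(ι, f) ≤ L^{−JD}` — for each contour
parameter `t < Lᴶ` at most ONE index bond of level `J` (direction `dir f`, source block that of `f₋ − te_μ`) sees `f`; the straight-tube averages of one
level form a sub-partition of unity (cube twin of n06-i's `B6IndexBondLayersKLevelV1.sum_qwt_lvl_le`, proved here without the layer analysis).
[cite: Balaban1984PropagatorsI, (1.18) p.20, (1.15) p.19; Balaban1984PropagatorsII, (2.20) p.226; Balaban1985BackgroundPropagators, p.409 l.3–5] -/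
theorem sum_qKc_lvl_le (J : ℕ) (f : FBondY i) :
    ∑ ι ∈ Finset.univ.filter (fun ι : IBondCubeY i q => (ι.1.1 : ℕ) = J), qKc i q ι f ≤ ((((ℓ + 1 : ℕ) : ℝ) ^ (d + 1)) ^ J)⁻¹ := by
  set S := Finset.univ.filter (fun ι : IBondCubeY i q => (ι.1.1 : ℕ) = J) with hS
  have h1 : ∑ ι ∈ S, qKc i q ι f ≤ ∑ ι ∈ S, cQ (d := d) (ℓ := ℓ) J * ∑ t ∈ Finset.range ((ℓ + 1) ^ J),
      (if ι.1.2.dir = f.dir ∧ iterBlockOf (ι.1.1 : ℕ) (backSite f.src f.dir t) = ι.1.2.src then (1 : ℝ) else 0) :=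
    Finset.sum_le_sum fun ι hι => qKc_le_count i q ι f (Finset.mem_filter.1 hι).2
  refine h1.trans ?_
  rw [← Finset.mul_sum, Finset.sum_comm, ← cQ_mul_pow (d := d) (ℓ := ℓ) J]
  refine mul_le_mul_of_nonneg_left ?_ (cQ_pos _).le
  -- for each `t`: at most one `ι ∈ S` satisfies the condition
  have hone : ∀ t ∈ Finset.range ((ℓ + 1) ^ J),
      ∑ ι ∈ S, (if ι.1.2.dir = f.dir ∧ iterBlockOf (ι.1.1 : ℕ) (backSite f.src f.dir t) = ι.1.2.src then (1 : ℝ) else 0) ≤ 1 := by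
    intro t _
    rw [Finset.sum_boole]
    have : (S.filter fun ι : IBondCubeY i q =>
        ι.1.2.dir = f.dir ∧ iterBlockOf (ι.1.1 : ℕ) (backSite f.src f.dir t) = ι.1.2.src).card ≤ 1 := by
      refine Finset.card_le_one.2 fun a ha b hb => ?_
      rw [Finset.mem_filter, hS, Finset.mem_filter] at ha hb
      exact eq_of_lvl_dir_src i q (ha.1.2.trans hb.1.2.symm) (ha.2.1.trans hb.2.1.symm) hb.2.2 ha.2.2
    exact_mod_cast this
  refine (Finset.sum_le_sum hone).trans ?_
  rw [Finset.sum_const, Finset.card_range, nsmul_eq_mul, mul_one]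
  push_cast
  exact le_rfl

/-- `(Lⁿ)^{−J} ≤ (1/2)^J` for `n ≥ 1` (`L ≥ 2`). [cite: Balaban1984PropagatorsII, (2.1) p.224, bookkeeping] -/
theorem inv_pow_pow_le_half_pow (hL1 : 1 < ℓ + 1) {n : ℕ} (hn : n ≠ 0) (J : ℕ) : ((((ℓ + 1 : ℕ) : ℝ) ^ n) ^ J)⁻¹ ≤ (1 / 2 : ℝ) ^ J := by
  rw [← inv_pow, ← one_div]
  refine pow_le_pow_left₀ (by positivity) ?_ J
  have hL2 : (2 : ℝ) ≤ ((ℓ + 1 : ℕ) : ℝ) := by exact_mod_cast hL1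
  exact one_div_le_one_div_of_le (by norm_num) (hL2.trans (le_self_pow₀ (by linarith) hn))

/-- `L^{−J(d+1)} ≤ (1/2)^J`. [cite: Balaban1984PropagatorsII, (2.1) p.224, bookkeeping] -/
theorem plateau_le_half_pow (hL1 : 1 < ℓ + 1) (J : ℕ) : ((((ℓ + 1 : ℕ) : ℝ) ^ (d + 1)) ^ J)⁻¹ ≤ (1 / 2 : ℝ) ^ J :=
  inv_pow_pow_le_half_pow hL1 (Nat.succ_ne_zero d) J

open Classical in
/-- ★ **SMALL COLUMNS**: `Σ_ι q_□(ι, f) ≤ 2` — summing the plateaux `L^{−JD}` over the levels `J = 0, …, k`.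
[cite: Balaban1984PropagatorsI, (1.18) p.20; Balaban1984PropagatorsII, (2.20) p.226; Balaban1985BackgroundPropagators, (3.12)–(3.14) pp.392–393, p.409 l.3–5] -/
theorem sum_qKc_col_le_two (f : FBondY i) : ∑ ι, qKc i q ι f ≤ 2 := by
  have hmaps : ∀ ι ∈ (Finset.univ : Finset (IBondCubeY i q)), (ι.1.1 : ℕ) ∈ Finset.range (i.k + 1) :=
    fun ι _ => Finset.mem_range.2 ι.1.1.2
  rw [← Finset.sum_fiberwise_of_maps_to hmaps]
  calc ∑ J ∈ Finset.range (i.k + 1), ∑ ι ∈ Finset.univ.filter (fun ι : IBondCubeY i q => (ι.1.1 : ℕ) = J), qKc i q ι f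
      ≤ ∑ J ∈ Finset.range (i.k + 1), (1 / 2 : ℝ) ^ J :=
        Finset.sum_le_sum fun J _ => (sum_qKc_lvl_le i q J f).trans (plateau_le_half_pow hL.2 J)
    _ ≤ 2 := sum_geometric_two_le _

/-- `Σ_ι |q*_□(b, ι)| ≤ 2` (the `Q*_□` kernel is the transpose). [cite: Balaban1985BackgroundPropagators, (3.13) p.392, p.409 l.3–5; Balaban1984PropagatorsII, (2.18) p.226] -/
theorem sum_abs_qsKc_le_two (b : FBondY i) : ∑ ι, |qsKc i q b ι| ≤ 2 := by
  refine le_trans (le_of_eq (Finset.sum_congr rfl fun ι _ => ?_)) (sum_qKc_col_le_two i q b)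
  rw [qsKc_eq_transpose, Matrix.transpose_apply, abs_of_nonneg (qKc_nonneg i q ι b)]

/-- the weight of one index bond against its plateau: `w_□(ι)·L^{−j(ι)D} ≤ b₁·(c_f/L^{j(ι)})²` (the band (2.16)). [cite: Balaban1984PropagatorsII, (2.16) p.225, (2.90) p.239] -/
theorem wCubeBond_mul_plateau_le (hb₁ : b₀ ≤ b₁) (ι : IBondCubeY i q) :
    wCubeBond i q ι * ((((ℓ + 1 : ℕ) : ℝ) ^ (d + 1)) ^ (ι.1.1 : ℕ))⁻¹ ≤ b₁ * (i.cf / (((ℓ + 1 : ℕ) : ℝ)) ^ (ι.1.1 : ℕ)) ^ 2 := by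
  have h := (wCubeBond_band i q hb₁ ι).2
  have hL0 : (0 : ℝ) < (((ℓ + 1 : ℕ) : ℝ)) ^ (ι.1.1 : ℕ) := by positivity
  have hq : (0 : ℝ) < (i.cf / (((ℓ + 1 : ℕ) : ℝ)) ^ (ι.1.1 : ℕ)) ^ 2 := by
    have : i.cf / (((ℓ + 1 : ℕ) : ℝ)) ^ (ι.1.1 : ℕ) ≠ 0 := div_ne_zero i.hcf hL0.ne'
    positivity
  have hP : (0 : ℝ) < (((ℓ + 1 : ℕ) : ℝ) ^ (d + 1)) ^ (ι.1.1 : ℕ) := by positivity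
  rw [div_le_iff₀ hq] at h
  rw [← div_eq_mul_inv, div_le_iff₀ hP]
  calc wCubeBond i q ι ≤ b₁ * ((((ℓ + 1 : ℕ) : ℝ)) ^ (ι.1.1 : ℕ)) ^ (d + 1) * (i.cf / (((ℓ + 1 : ℕ) : ℝ)) ^ (ι.1.1 : ℕ)) ^ 2 := h
    _ = b₁ * (i.cf / (((ℓ + 1 : ℕ) : ℝ)) ^ (ι.1.1 : ℕ)) ^ 2 * (((ℓ + 1 : ℕ) : ℝ) ^ (d + 1)) ^ (ι.1.1 : ℕ) := by
        rw [← pow_mul, ← pow_mul, mul_comm (d + 1)]; ring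

open Classical in
/-- ★ **THE WEIGHTED COLUMN SUM IS `O(1)`**: `Σ_ι w_□(ι)·q_□(ι, f) ≤ 2·b₁·c_f²` — level `J` contributes at most `b₁(c_f/Lᴶ)²` (plateau × band), and
`Σ_J L^{−2J} ≤ 2`; this is the size of `Q*_□ a_□ Q_□` as a kernel on fine bonds (print's `a_j(Lʲη)⁻²` in lattice units, summed over the levels).
[cite: Balaban1984PropagatorsII, (2.16) p.225, (2.20) p.226; Balaban1985BackgroundPropagators, (3.26) p.395, (3.83) p.407, p.409 l.3–5] -/
theorem sum_wCubeBond_mul_qKc_le (hb₀ : 0 < b₀) (hb₁ : b₀ ≤ b₁) (f : FBondY i) :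
    ∑ ι, wCubeBond i q ι * qKc i q ι f ≤ 2 * b₁ * i.cf ^ 2 := by
  have hb1 : 0 ≤ b₁ := hb₀.le.trans hb₁
  have hmaps : ∀ ι ∈ (Finset.univ : Finset (IBondCubeY i q)), (ι.1.1 : ℕ) ∈ Finset.range (i.k + 1) :=
    fun ι _ => Finset.mem_range.2 ι.1.1.2
  rw [← Finset.sum_fiberwise_of_maps_to hmaps]
  -- one level: `Σ_{ι ∈ S_J} w q ≤ b₁ (cf/Lᴶ)² L^{JD} · Σ_{S_J} q ≤ b₁ (cf/Lᴶ)²`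
  have hlvl : ∀ J ∈ Finset.range (i.k + 1),
      ∑ ι ∈ Finset.univ.filter (fun ι : IBondCubeY i q => (ι.1.1 : ℕ) = J), wCubeBond i q ι * qKc i q ι f ≤
        b₁ * i.cf ^ 2 * (1 / 2 : ℝ) ^ J := by
    intro J _
    have hP : (0 : ℝ) < (((ℓ + 1 : ℕ) : ℝ) ^ (d + 1)) ^ J := by positivity
    have hterm : ∀ ι ∈ Finset.univ.filter (fun ι : IBondCubeY i q => (ι.1.1 : ℕ) = J), wCubeBond i q ι * qKc i q ι f ≤
        (b₁ * (i.cf / (((ℓ + 1 : ℕ) : ℝ)) ^ J) ^ 2 * (((ℓ + 1 : ℕ) : ℝ) ^ (d + 1)) ^ J) * qKc i q ι f := by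
      intro ι hι
      have hl : (ι.1.1 : ℕ) = J := (Finset.mem_filter.1 hι).2
      refine mul_le_mul_of_nonneg_right ?_ (qKc_nonneg i q ι f)
      have h := wCubeBond_mul_plateau_le i q hb₁ ι
      rw [hl, ← div_eq_mul_inv, div_le_iff₀ hP] at h
      exact h
    refine (Finset.sum_le_sum hterm).trans ?_
    rw [← Finset.mul_sum]
    calc b₁ * (i.cf / (((ℓ + 1 : ℕ) : ℝ)) ^ J) ^ 2 * (((ℓ + 1 : ℕ) : ℝ) ^ (d + 1)) ^ J *
          ∑ ι ∈ Finset.univ.filter (fun ι : IBondCubeY i q => (ι.1.1 : ℕ) = J), qKc i q ι f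
        ≤ b₁ * (i.cf / (((ℓ + 1 : ℕ) : ℝ)) ^ J) ^ 2 * (((ℓ + 1 : ℕ) : ℝ) ^ (d + 1)) ^ J * ((((ℓ + 1 : ℕ) : ℝ) ^ (d + 1)) ^ J)⁻¹ :=
          mul_le_mul_of_nonneg_left (sum_qKc_lvl_le i q J f) (by positivity)
      _ = b₁ * i.cf ^ 2 * (((((ℓ + 1 : ℕ) : ℝ)) ^ J) ^ 2)⁻¹ := by
          rw [mul_assoc, mul_inv_cancel₀ hP.ne', mul_one, div_pow]; ring
      _ ≤ b₁ * i.cf ^ 2 * (1 / 2 : ℝ) ^ J := by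
          refine mul_le_mul_of_nonneg_left ?_ (by positivity)
          rw [← pow_mul, mul_comm, pow_mul]
          exact inv_pow_pow_le_half_pow hL.2 two_ne_zero J
  refine (Finset.sum_le_sum hlvl).trans ?_
  rw [← Finset.mul_sum]
  calc b₁ * i.cf ^ 2 * ∑ J ∈ Finset.range (i.k + 1), (1 / 2 : ℝ) ^ J ≤ b₁ * i.cf ^ 2 * 2 :=
        mul_le_mul_of_nonneg_left (sum_geometric_two_le _) (by positivity)
    _ = 2 * b₁ * i.cf ^ 2 := by ring

variable {𝔸 : Type} [NormedRing 𝔸] [NormedAlgebra ℂ 𝔸] [CompleteSpace 𝔸]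

omit [CompleteSpace 𝔸] in
/-- `(a_□ X)(ι) = w_□(ι)•X(ι)` — the weight of (3.26) is diagonal. [cite: Balaban1985BackgroundPropagators, (3.26) p.395, p.409 l.1–5; Balaban1984PropagatorsII, (2.20) p.226] -/
theorem aCubeY_apply (X : IBondCubeY i q → 𝔸) (ι : IBondCubeY i q) : aCubeY (𝔸 := 𝔸) i q X ι = ((wCubeBond i q ι : ℝ) : ℂ) • X ι := by
  classical
  show liftMatY 𝔸 (aKc i q) X ι = _
  rw [aKc_eq_diagonal, liftMatY_apply, Finset.sum_eq_single ι]
  · rw [Matrix.diagonal_apply_eq]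
  · intro ι' _ hne; rw [Matrix.diagonal_apply_ne _ (Ne.symm hne), Complex.ofReal_zero, zero_smul]
  · intro h; exact absurd (Finset.mem_univ ι) h

omit [CompleteSpace 𝔸] in
/-- `‖(a_□ X)(ι)‖ = w_□(ι)·‖X(ι)‖` (`w_□ > 0`). [cite: Balaban1985BackgroundPropagators, (3.26) p.395, bookkeeping] -/
theorem norm_aCubeY_apply [NormOneClass 𝔸] (hb₀ : 0 < b₀) (X : IBondCubeY i q → 𝔸) (ι : IBondCubeY i q) :
    ‖aCubeY (𝔸 := 𝔸) i q X ι‖ = wCubeBond i q ι * ‖X ι‖ := by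
  rw [aCubeY_apply, norm_smul, Complex.norm_real, Real.norm_eq_abs, abs_of_pos (wCubeBond_pos i q hb₀ ι)]

end Kernel

/-! ## §3 (3.83) POINTWISE: the averaging-expansion piece `Q*_□(U′U)a_□Q_□(U′U) − Q*_□(U)a_□Q_□(U)` in the weighted sup currency -/

section Pointwise

open Literature.MathematicalPhysics.QuantumFieldTheory.Balaban1983to89.B6KLevelCensusIndexV1 (KIdx)
open Literature.MathematicalPhysics.QuantumFieldTheory.Balaban1983to89.B6Cover236MultiLevelBlocks (cubes)
open Literature.MathematicalPhysics.QuantumFieldTheory.Balaban1983to89.B6GlobalChartV1 (PV)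
open Literature.MathematicalPhysics.QuantumFieldTheory.Balaban1983to89.B15DeterminingSets (embIter)
open Literature.MathematicalPhysics.QuantumFieldTheory.Balaban1983to89.B9CubeLettersBondOpsL0 (IBondCubeY qKc qsKc qTc aCubeY QCubeY QsCubeY)
open Literature.MathematicalPhysics.QuantumFieldTheory.Balaban1983to89.B9CubeBondWeights (wCubeBond wCubeBond_pos)
open Literature.MathematicalPhysics.QuantumFieldTheory.Balaban1983to89.B9Eq380CubeLetters (unitaryLike_qTc_parBY norm_QCubeY_mul_sub_apply_le
  norm_QsCubeY_mul_sub_apply_le tdist_of_qKc_ne_zero_le mul_one_cfg)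
open Literature.MathematicalPhysics.QuantumFieldTheory.Balaban1983to89.B9Eq3104CutoffCommutators (norm_trLiftY_apply_le)

variable {d ℓ : ℕ} {hd : 1 ≤ d + 1} {hL : Odd (ℓ + 1) ∧ 1 < ℓ + 1} {b₀ b₁ : ℝ}
variable {𝔸 : Type} [NormedRing 𝔸] [NormedAlgebra ℂ 𝔸] [CompleteSpace 𝔸]
variable (i : KIdx d ℓ hd hL b₀ b₁) (q : ↥(cubes (toKT i).D.toDomains))

omit [CompleteSpace 𝔸] in
/-- the (3.82) bookkeeping of the averaging term, applied to vectors: `S₁X₁ − S₀X₀ = (S₁ − S₀)X₀ + S₀(X₁ − X₀) + (S₁ − S₀)(X₁ − X₀)` — with `S = Q*_□`, `X = a_□Q_□A`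
this is print's «F₂*aQ(U) + Q*(U)aF₂ + F₂*aF₂». [cite: Balaban1985BackgroundPropagators, (3.82) p.407, bookkeeping] -/
theorem apply_sub_apply_eq_three_terms {E F : Type} [AddCommGroup E] [AddCommGroup F] [Module ℂ E] [Module ℂ F] (S₀ S₁ : F →ₗ[ℂ] E) (X₀ X₁ : F) :
    S₁ X₁ - S₀ X₀ = (S₁ X₀ - S₀ X₀) + S₀ (X₁ - X₀) + (S₁ (X₁ - X₀) - S₀ (X₁ - X₀)) := by
  rw [map_sub, map_sub]; abel

variable [NormOneClass 𝔸]

/-- ★ **THE WEIGHTED SIZE OF ONE AVERAGE**: `w_□(ι)·‖A(f)‖ ≤ P` on the support of `q_□(ι, ·)` ⟹ `w_□(ι)·‖(Q_□(U)A)(ι)‖ ≤ P` (unit row sums; cube twin of p38's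
`B9Eq3104CommutatorSizesAvg.mul_norm_QY_apply_le`). [cite: Balaban1985BackgroundPropagators, (3.12)–(3.14) pp.392–393, (3.26) p.395, p.409 l.3–5] -/
theorem mul_norm_QCubeY_apply_le (hb₀ : 0 < b₀) {U : CfgY 𝔸 i} (hU : ∀ μ x, UnitaryLike (U μ x)) (A : FBondY i → 𝔸) (ι : IBondCubeY i q)
    {P : ℝ} (hA : ∀ f, qKc i q ι f ≠ 0 → wCubeBond i q ι * ‖A f‖ ≤ P) :
    wCubeBond i q ι * ‖QCubeY i q (parBY i) U A ι‖ ≤ P := by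
  have hw : 0 ≤ wCubeBond i q ι := (wCubeBond_pos i q hb₀ ι).le
  have e : ‖QCubeY i q (parBY i) U A ι‖ ≤ ∑ f, |qKc i q ι f| * ‖A f‖ :=
    norm_trLiftY_apply_le (qKc i q) (fun ι f => unitaryLike_qTc_parBY i q hU ι f) A ι
  calc wCubeBond i q ι * ‖QCubeY i q (parBY i) U A ι‖ ≤ wCubeBond i q ι * ∑ f, |qKc i q ι f| * ‖A f‖ := mul_le_mul_of_nonneg_left e hw
    _ = ∑ f, |qKc i q ι f| * (wCubeBond i q ι * ‖A f‖) := by rw [Finset.mul_sum]; exact Finset.sum_congr rfl fun f _ => by ring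
    _ ≤ ∑ f, |qKc i q ι f| * P := by
        refine Finset.sum_le_sum fun f _ => ?_
        by_cases hq : qKc i q ι f = 0
        · rw [hq, abs_zero, zero_mul, zero_mul]
        · exact mul_le_mul_of_nonneg_left (hA f hq) (abs_nonneg _)
    _ = P := by rw [← Finset.sum_mul, sum_abs_qKc_eq_one, one_mul]

/-- (GENERAL AVERAGING RANGE `Da` — any bound `q_□(ι,b) ≠ 0 ⟹ |embIter j(ι) ι₋ − b₋|₁ ≤ Da`, e.g. the level-sharp one of the cube at hand) ★ **THE WEIGHTED SIZE OF ONE EXPANDED AVERAGE**: under (3.81)'s hypotheses around the base point of `ι` and `w_□(ι)·‖A(f)‖ ≤ P` on the support,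
`w_□(ι)·‖(F₂A)(ι)‖ ≤ 2Dρ·P`, `F₂ = Q_□(U′U) − Q_□(U)`, `D = (d+2)(Lᵏ − 1)`. [cite: Balaban1985BackgroundPropagators, (3.80)–(3.81) pp.406–407, (3.83) p.407] -/
theorem mul_norm_F2_apply_le_ofRange (hb₀ : 0 < b₀) {U V : CfgY 𝔸 i} (hU : ∀ μ x, UnitaryLike (U μ x)) (hV : ∀ μ x, UnitaryLike (V μ x)) {ρ : ℝ} (hρ : 0 ≤ ρ)
    {Da : ℕ} (hDa : ∀ (ι : IBondCubeY i q) (b : FBondY i), qKc i q ι b ≠ 0 → Site.tdist (embIter (ι.1.1 : ℕ) ι.1.2.src) b.src ≤ Da)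
    (A : FBondY i → 𝔸) (ι : IBondCubeY i q)
    (hsmall : ∀ (ν : Fin (d + 1)) (w : Site (PV d ℓ i.m i.K hd hL) 0),
      supDist (embIter (ι.1.1 : ℕ) ι.1.2.src) w ≤ Da → ‖(V ν w : 𝔸) - 1‖ ≤ ρ)
    {P : ℝ} (hA : ∀ f, qKc i q ι f ≠ 0 → wCubeBond i q ι * ‖A f‖ ≤ P) :
    wCubeBond i q ι * ‖(QCubeY i q (parBY i) (fun μ x => V μ x * U μ x) A - QCubeY i q (parBY i) U A) ι‖ ≤
      2 * (Da : ℝ) * ρ * P := by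
  have hw : 0 ≤ wCubeBond i q ι := (wCubeBond_pos i q hb₀ ι).le
  have hD : (0 : ℝ) ≤ 2 * (Da : ℝ) * ρ := by positivity
  have e := norm_QCubeY_mul_sub_apply_le i q hU hV hρ hDa ι hsmall A
  calc wCubeBond i q ι * ‖(QCubeY i q (parBY i) (fun μ x => V μ x * U μ x) A - QCubeY i q (parBY i) U A) ι‖
      ≤ wCubeBond i q ι * (2 * (Da : ℝ) * ρ * ∑ f, |qKc i q ι f| * ‖A f‖) := mul_le_mul_of_nonneg_left e hw
    _ = 2 * (Da : ℝ) * ρ * ∑ f, |qKc i q ι f| * (wCubeBond i q ι * ‖A f‖) := by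
        rw [Finset.mul_sum, Finset.mul_sum, Finset.mul_sum]; exact Finset.sum_congr rfl fun f _ => by ring
    _ ≤ 2 * (Da : ℝ) * ρ * ∑ f, |qKc i q ι f| * P := by
        refine mul_le_mul_of_nonneg_left (Finset.sum_le_sum fun f _ => ?_) hD
        by_cases hq : qKc i q ι f = 0
        · rw [hq, abs_zero, zero_mul, zero_mul]
        · exact mul_le_mul_of_nonneg_left (hA f hq) (abs_nonneg _)
    _ = 2 * (Da : ℝ) * ρ * P := by rw [← Finset.sum_mul, sum_abs_qKc_eq_one, one_mul]

/-- (THE RANGE DISCHARGED UNIFORMLY: `Da = (d+2)(Lᵏ − 1)`, `B9Eq380CubeLetters.tdist_of_qKc_ne_zero_le`) ★ **THE WEIGHTED SIZE OF ONE EXPANDED AVERAGE**: under (3.81)'s hypotheses around the base point of `ι` and `w_□(ι)·‖A(f)‖ ≤ P` on the support,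
`w_□(ι)·‖(F₂A)(ι)‖ ≤ 2Dρ·P`, `F₂ = Q_□(U′U) − Q_□(U)`, `D = (d+2)(Lᵏ − 1)`. [cite: Balaban1985BackgroundPropagators, (3.80)–(3.81) pp.406–407, (3.83) p.407] -/
theorem mul_norm_F2_apply_le (hb₀ : 0 < b₀) {U V : CfgY 𝔸 i} (hU : ∀ μ x, UnitaryLike (U μ x)) (hV : ∀ μ x, UnitaryLike (V μ x)) {ρ : ℝ} (hρ : 0 ≤ ρ)
    (A : FBondY i → 𝔸) (ι : IBondCubeY i q)
    (hsmall : ∀ (ν : Fin (d + 1)) (w : Site (PV d ℓ i.m i.K hd hL) 0),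
      supDist (embIter (ι.1.1 : ℕ) ι.1.2.src) w ≤ (d + 2) * ((ℓ + 1) ^ i.k - 1) → ‖(V ν w : 𝔸) - 1‖ ≤ ρ)
    {P : ℝ} (hA : ∀ f, qKc i q ι f ≠ 0 → wCubeBond i q ι * ‖A f‖ ≤ P) :
    wCubeBond i q ι * ‖(QCubeY i q (parBY i) (fun μ x => V μ x * U μ x) A - QCubeY i q (parBY i) U A) ι‖ ≤
      2 * (((d + 2) * ((ℓ + 1) ^ i.k - 1) : ℕ) : ℝ) * ρ * P :=
  mul_norm_F2_apply_le_ofRange i q hb₀ hU hV hρ (tdist_of_qKc_ne_zero_le i q) A ι hsmall hA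

/-- (GENERAL AVERAGING RANGE `Da` — any bound `q_□(ι,b) ≠ 0 ⟹ |embIter j(ι) ι₋ − b₋|₁ ≤ Da`, e.g. the level-sharp one of the cube at hand) ★★★ **(3.83) AT THE CUBE LETTERS, POINTWISE** — «The operator P₂(A) is a sum of three terms obtained by the expansion of averaging operators. It is a
semi-local operator … It satisfies the bound |(P₂(A)A′)(b)| ≦ O(1)α₁(Lʲη)⁻²|A′|, b ∈ B_j(Λ_j), with the norm |A′| restricted to the blocks defined above»:
for unitary-like `U, U′`, `‖U′(b′) − 1‖ ≤ ρ` within `ℓ^∞`-distance `D = (d+2)(Lᵏ − 1)` of the base point of every index bond `ι` whose stencil sees `b`, and the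
LEVEL-WEIGHTED amplitude bound `w_□(ι)·‖A(f)‖ ≤ P` on the double support (`q*_□(b, ι) ≠ 0`, `q_□(ι, f) ≠ 0` — print's «blocks neighbouring the block
containing the bond b», the factor `(Lʲη)⁻²` inside `w_□`):
`‖(Q*_□(U′U)a_□Q_□(U′U)A − Q*_□(U)a_□Q_□(U)A)(b)‖ ≤ 4Dρ(1 + Dρ)·P·Σ_ι |q*_□(b, ι)|` (`O(1)α₁ = 4Dρ(1 + Dρ)`; the three terms contribute `2Dρ`, `2Dρ`, `4D²ρ²`).
[cite: Balaban1985BackgroundPropagators, (3.82)–(3.83) p.407, (3.80)–(3.81) pp.406–407, (3.26) p.395, p.409 l.1–5] -/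
theorem norm_QsaQCubeY_mul_sub_apply_le_ofRange (hb₀ : 0 < b₀) {U V : CfgY 𝔸 i} (hU : ∀ μ x, UnitaryLike (U μ x)) (hV : ∀ μ x, UnitaryLike (V μ x))
    {ρ : ℝ} (hρ : 0 ≤ ρ)
    {Da : ℕ} (hDa : ∀ (ι : IBondCubeY i q) (b : FBondY i), qKc i q ι b ≠ 0 → Site.tdist (embIter (ι.1.1 : ℕ) ι.1.2.src) b.src ≤ Da) (b : FBondY i)
    (hsmall : ∀ ι : IBondCubeY i q, qsKc i q b ι ≠ 0 → ∀ (ν : Fin (d + 1)) (w : Site (PV d ℓ i.m i.K hd hL) 0),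
      supDist (embIter (ι.1.1 : ℕ) ι.1.2.src) w ≤ Da → ‖(V ν w : 𝔸) - 1‖ ≤ ρ)
    (A : FBondY i → 𝔸) {P : ℝ} (hA : ∀ (ι : IBondCubeY i q) (f : FBondY i), qsKc i q b ι ≠ 0 → qKc i q ι f ≠ 0 → wCubeBond i q ι * ‖A f‖ ≤ P) :
    ‖(QsCubeY i q (parBY i) (fun μ x => V μ x * U μ x) (aCubeY i q (QCubeY i q (parBY i) (fun μ x => V μ x * U μ x) A)) -
        QsCubeY i q (parBY i) U (aCubeY i q (QCubeY i q (parBY i) U A))) b‖ ≤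
      4 * (Da : ℝ) * ρ * (1 + (Da : ℝ) * ρ) * P * ∑ ι, |qsKc i q b ι| := by
  set D : ℝ := (Da : ℝ) with hDdef
  have hD0 : 0 ≤ D := by rw [hDdef]; positivity
  set X₀ : IBondCubeY i q → 𝔸 := aCubeY i q (QCubeY i q (parBY i) U A) with hX₀
  set X₁ : IBondCubeY i q → 𝔸 := aCubeY i q (QCubeY i q (parBY i) (fun μ x => V μ x * U μ x) A) with hX₁
  have hVU : ∀ μ x, UnitaryLike (V μ x * U μ x) := fun μ x => (hV μ x).mul (hU μ x)
  -- the weighted sizes of `X₀ = a_□Q_□(U)A` and of `X₁ − X₀ = a_□F₂A` on the index bonds seeing `b`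
  have hX0 : ∀ ι, qsKc i q b ι ≠ 0 → ‖X₀ ι‖ ≤ P := by
    intro ι hι
    rw [hX₀, norm_aCubeY_apply i q hb₀]
    exact mul_norm_QCubeY_apply_le i q hb₀ hU A ι (fun f hf => hA ι f hι hf)
  have hX10 : X₁ - X₀ = aCubeY i q (QCubeY i q (parBY i) (fun μ x => V μ x * U μ x) A - QCubeY i q (parBY i) U A) := by
    rw [hX₁, hX₀, map_sub]
  have hX1 : ∀ ι, qsKc i q b ι ≠ 0 → ‖(X₁ - X₀) ι‖ ≤ 2 * D * ρ * P := by
    intro ι hι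
    rw [hX10, norm_aCubeY_apply i q hb₀]
    exact mul_norm_F2_apply_le_ofRange i q hb₀ hU hV hρ hDa A ι (hsmall ι hι) (fun f hf => hA ι f hι hf)
  -- the three terms of (3.82)
  have hsplit := apply_sub_apply_eq_three_terms (QsCubeY i q (parBY i) U) (QsCubeY i q (parBY i) (fun μ x => V μ x * U μ x)) X₀ X₁
  have happ := congrArg (fun g : FBondY i → 𝔸 => g b) hsplit
  simp only [Pi.add_apply, Pi.sub_apply] at happ
  -- term 1: `F₂* X₀`
  have hT1 : ‖QsCubeY i q (parBY i) (fun μ x => V μ x * U μ x) X₀ b - QsCubeY i q (parBY i) U X₀ b‖ ≤ 2 * D * ρ * (P * ∑ ι, |qsKc i q b ι|) := by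
    have e := norm_QsCubeY_mul_sub_apply_le i q hU hV hρ hDa b hsmall X₀
    rw [Pi.sub_apply] at e
    have hterm : ∑ ι, |qsKc i q b ι| * ‖X₀ ι‖ ≤ ∑ ι, |qsKc i q b ι| * P :=
      Finset.sum_le_sum fun ι _ => by
        by_cases hι : qsKc i q b ι = 0
        · rw [hι, abs_zero, zero_mul, zero_mul]
        · exact mul_le_mul_of_nonneg_left (hX0 ι hι) (abs_nonneg _)
    rw [← Finset.sum_mul] at hterm
    calc _ ≤ 2 * D * ρ * ∑ ι, |qsKc i q b ι| * ‖X₀ ι‖ := e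
      _ ≤ 2 * D * ρ * ((∑ ι, |qsKc i q b ι|) * P) := mul_le_mul_of_nonneg_left hterm (by positivity)
      _ = 2 * D * ρ * (P * ∑ ι, |qsKc i q b ι|) := by ring
  -- term 2: `Q*_□(U)(X₁ − X₀)`
  have hT2 : ‖QsCubeY i q (parBY i) U (X₁ - X₀) b‖ ≤ 2 * D * ρ * (P * ∑ ι, |qsKc i q b ι|) := by
    have e : ‖QsCubeY i q (parBY i) U (X₁ - X₀) b‖ ≤ ∑ ι, |qsKc i q b ι| * ‖(X₁ - X₀) ι‖ :=
      norm_trLiftY_apply_le (qsKc i q) (fun b ι => ⟨(unitaryLike_qTc_parBY i q hU ι b).2, by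
        rw [inv_inv]; exact (unitaryLike_qTc_parBY i q hU ι b).1⟩) (X₁ - X₀) b
    have hterm : ∑ ι, |qsKc i q b ι| * ‖(X₁ - X₀) ι‖ ≤ ∑ ι, |qsKc i q b ι| * (2 * D * ρ * P) :=
      Finset.sum_le_sum fun ι _ => by
        by_cases hι : qsKc i q b ι = 0
        · rw [hι, abs_zero, zero_mul, zero_mul]
        · exact mul_le_mul_of_nonneg_left (hX1 ι hι) (abs_nonneg _)
    rw [← Finset.sum_mul] at hterm
    calc _ ≤ ∑ ι, |qsKc i q b ι| * ‖(X₁ - X₀) ι‖ := e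
      _ ≤ (∑ ι, |qsKc i q b ι|) * (2 * D * ρ * P) := hterm
      _ = 2 * D * ρ * (P * ∑ ι, |qsKc i q b ι|) := by ring
  -- term 3: `F₂* (X₁ − X₀)`
  have hT3 : ‖QsCubeY i q (parBY i) (fun μ x => V μ x * U μ x) (X₁ - X₀) b - QsCubeY i q (parBY i) U (X₁ - X₀) b‖ ≤
      2 * D * ρ * (2 * D * ρ * (P * ∑ ι, |qsKc i q b ι|)) := by
    have e := norm_QsCubeY_mul_sub_apply_le i q hU hV hρ hDa b hsmall (X₁ - X₀)
    rw [Pi.sub_apply] at e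
    have hterm : ∑ ι, |qsKc i q b ι| * ‖(X₁ - X₀) ι‖ ≤ ∑ ι, |qsKc i q b ι| * (2 * D * ρ * P) :=
      Finset.sum_le_sum fun ι _ => by
        by_cases hι : qsKc i q b ι = 0
        · rw [hι, abs_zero, zero_mul, zero_mul]
        · exact mul_le_mul_of_nonneg_left (hX1 ι hι) (abs_nonneg _)
    rw [← Finset.sum_mul] at hterm
    calc _ ≤ 2 * D * ρ * ∑ ι, |qsKc i q b ι| * ‖(X₁ - X₀) ι‖ := e
      _ ≤ 2 * D * ρ * ((∑ ι, |qsKc i q b ι|) * (2 * D * ρ * P)) := mul_le_mul_of_nonneg_left hterm (by positivity)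
      _ = 2 * D * ρ * (2 * D * ρ * (P * ∑ ι, |qsKc i q b ι|)) := by ring
  -- assemble
  have hgoal : QsCubeY i q (parBY i) (fun μ x => V μ x * U μ x) X₁ b - QsCubeY i q (parBY i) U X₀ b =
      (QsCubeY i q (parBY i) (fun μ x => V μ x * U μ x) X₀ b - QsCubeY i q (parBY i) U X₀ b) + QsCubeY i q (parBY i) U (X₁ - X₀) b +
        (QsCubeY i q (parBY i) (fun μ x => V μ x * U μ x) (X₁ - X₀) b - QsCubeY i q (parBY i) U (X₁ - X₀) b) := happ
  rw [Pi.sub_apply, hgoal]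
  refine (norm_add_le _ _).trans ((add_le_add (norm_add_le _ _) le_rfl).trans ?_)
  have hsum : 0 ≤ P * ∑ ι, |qsKc i q b ι| := by
    by_cases hS : ∑ ι, |qsKc i q b ι| = 0
    · rw [hS, mul_zero]
    · -- some `ι` sees `b`; its row has a fine bond in the support, where `P ≥ w‖A‖ ≥ 0`
      obtain ⟨ι, -, hι⟩ := Finset.exists_ne_zero_of_sum_ne_zero hS
      have hι' : qsKc i q b ι ≠ 0 := fun h => hι (by rw [h, abs_zero])
      have hrow := sum_abs_qKc_eq_one i q ι
      obtain ⟨f, -, hf⟩ := Finset.exists_ne_zero_of_sum_ne_zero (by rw [hrow]; exact one_ne_zero)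
      have hf' : qKc i q ι f ≠ 0 := fun h => hf (by rw [h, abs_zero])
      have hP : 0 ≤ P := le_trans (mul_nonneg (wCubeBond_pos i q hb₀ ι).le (norm_nonneg _)) (hA ι f hι' hf')
      exact mul_nonneg hP (Finset.sum_nonneg fun ι _ => abs_nonneg _)
  calc ‖QsCubeY i q (parBY i) (fun μ x => V μ x * U μ x) X₀ b - QsCubeY i q (parBY i) U X₀ b‖ + ‖QsCubeY i q (parBY i) U (X₁ - X₀) b‖ +
        ‖QsCubeY i q (parBY i) (fun μ x => V μ x * U μ x) (X₁ - X₀) b - QsCubeY i q (parBY i) U (X₁ - X₀) b‖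
      ≤ 2 * D * ρ * (P * ∑ ι, |qsKc i q b ι|) + 2 * D * ρ * (P * ∑ ι, |qsKc i q b ι|) + 2 * D * ρ * (2 * D * ρ * (P * ∑ ι, |qsKc i q b ι|)) :=
        add_le_add (add_le_add hT1 hT2) hT3
    _ = 4 * D * ρ * (1 + D * ρ) * P * ∑ ι, |qsKc i q b ι| := by ring

/-- (THE RANGE DISCHARGED UNIFORMLY: `Da = (d+2)(Lᵏ − 1)`, `B9Eq380CubeLetters.tdist_of_qKc_ne_zero_le`) ★★★ **(3.83) AT THE CUBE LETTERS, POINTWISE** — «The operator P₂(A) is a sum of three terms obtained by the expansion of averaging operators. It is a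
semi-local operator … It satisfies the bound |(P₂(A)A′)(b)| ≦ O(1)α₁(Lʲη)⁻²|A′|, b ∈ B_j(Λ_j), with the norm |A′| restricted to the blocks defined above»:
for unitary-like `U, U′`, `‖U′(b′) − 1‖ ≤ ρ` within `ℓ^∞`-distance `D = (d+2)(Lᵏ − 1)` of the base point of every index bond `ι` whose stencil sees `b`, and the
LEVEL-WEIGHTED amplitude bound `w_□(ι)·‖A(f)‖ ≤ P` on the double support (`q*_□(b, ι) ≠ 0`, `q_□(ι, f) ≠ 0` — print's «blocks neighbouring the block
containing the bond b», the factor `(Lʲη)⁻²` inside `w_□`):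
`‖(Q*_□(U′U)a_□Q_□(U′U)A − Q*_□(U)a_□Q_□(U)A)(b)‖ ≤ 4Dρ(1 + Dρ)·P·Σ_ι |q*_□(b, ι)|` (`O(1)α₁ = 4Dρ(1 + Dρ)`; the three terms contribute `2Dρ`, `2Dρ`, `4D²ρ²`).
[cite: Balaban1985BackgroundPropagators, (3.82)–(3.83) p.407, (3.80)–(3.81) pp.406–407, (3.26) p.395, p.409 l.1–5] -/
theorem norm_QsaQCubeY_mul_sub_apply_le (hb₀ : 0 < b₀) {U V : CfgY 𝔸 i} (hU : ∀ μ x, UnitaryLike (U μ x)) (hV : ∀ μ x, UnitaryLike (V μ x))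
    {ρ : ℝ} (hρ : 0 ≤ ρ) (b : FBondY i)
    (hsmall : ∀ ι : IBondCubeY i q, qsKc i q b ι ≠ 0 → ∀ (ν : Fin (d + 1)) (w : Site (PV d ℓ i.m i.K hd hL) 0),
      supDist (embIter (ι.1.1 : ℕ) ι.1.2.src) w ≤ (d + 2) * ((ℓ + 1) ^ i.k - 1) → ‖(V ν w : 𝔸) - 1‖ ≤ ρ)
    (A : FBondY i → 𝔸) {P : ℝ} (hA : ∀ (ι : IBondCubeY i q) (f : FBondY i), qsKc i q b ι ≠ 0 → qKc i q ι f ≠ 0 → wCubeBond i q ι * ‖A f‖ ≤ P) :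
    ‖(QsCubeY i q (parBY i) (fun μ x => V μ x * U μ x) (aCubeY i q (QCubeY i q (parBY i) (fun μ x => V μ x * U μ x) A)) -
        QsCubeY i q (parBY i) U (aCubeY i q (QCubeY i q (parBY i) U A))) b‖ ≤
      4 * (((d + 2) * ((ℓ + 1) ^ i.k - 1) : ℕ) : ℝ) * ρ * (1 + (((d + 2) * ((ℓ + 1) ^ i.k - 1) : ℕ) : ℝ) * ρ) * P * ∑ ι, |qsKc i q b ι| :=
  norm_QsaQCubeY_mul_sub_apply_le_ofRange i q hb₀ hU hV hρ (tdist_of_qKc_ne_zero_le i q) b hsmall A hA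

/-- ★★★ **(3.83) WITH THE COLUMN SUM DISCHARGED** (`Σ_ι |q*_□(b, ι)| ≤ 2`, §2): `‖(P₂A)(b)‖ ≤ 8Dρ(1 + Dρ)·P`.
[cite: Balaban1985BackgroundPropagators, (3.83) p.407, (3.13) p.392; Balaban1984PropagatorsI, (1.18) p.20] -/
theorem norm_QsaQCubeY_mul_sub_apply_le' (hb₀ : 0 < b₀) {U V : CfgY 𝔸 i} (hU : ∀ μ x, UnitaryLike (U μ x)) (hV : ∀ μ x, UnitaryLike (V μ x))
    {ρ : ℝ} (hρ : 0 ≤ ρ) (b : FBondY i)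
    (hsmall : ∀ ι : IBondCubeY i q, qsKc i q b ι ≠ 0 → ∀ (ν : Fin (d + 1)) (w : Site (PV d ℓ i.m i.K hd hL) 0),
      supDist (embIter (ι.1.1 : ℕ) ι.1.2.src) w ≤ (d + 2) * ((ℓ + 1) ^ i.k - 1) → ‖(V ν w : 𝔸) - 1‖ ≤ ρ)
    (A : FBondY i → 𝔸) {P : ℝ} (hP : 0 ≤ P)
    (hA : ∀ (ι : IBondCubeY i q) (f : FBondY i), qsKc i q b ι ≠ 0 → qKc i q ι f ≠ 0 → wCubeBond i q ι * ‖A f‖ ≤ P) :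
    ‖(QsCubeY i q (parBY i) (fun μ x => V μ x * U μ x) (aCubeY i q (QCubeY i q (parBY i) (fun μ x => V μ x * U μ x) A)) -
        QsCubeY i q (parBY i) U (aCubeY i q (QCubeY i q (parBY i) U A))) b‖ ≤
      8 * (((d + 2) * ((ℓ + 1) ^ i.k - 1) : ℕ) : ℝ) * ρ * (1 + (((d + 2) * ((ℓ + 1) ^ i.k - 1) : ℕ) : ℝ) * ρ) * P := by
  refine (norm_QsaQCubeY_mul_sub_apply_le i q hb₀ hU hV hρ b hsmall A hA).trans ?_
  have h2 := sum_abs_qsKc_le_two i q b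
  have hc : 0 ≤ 4 * (((d + 2) * ((ℓ + 1) ^ i.k - 1) : ℕ) : ℝ) * ρ * (1 + (((d + 2) * ((ℓ + 1) ^ i.k - 1) : ℕ) : ℝ) * ρ) * P := by positivity
  nlinarith

/-- ★★ **(3.83), GLOBAL-SMALLNESS FORM**: `‖U′(b) − 1‖ ≤ ρ` at EVERY bond and `w_□(ι)·‖A(f)‖ ≤ P` on EVERY support pair ⟹ `‖(P₂A)(b)‖ ≤ 8Dρ(1 + Dρ)·P` at every `b`.
[cite: Balaban1985BackgroundPropagators, (3.83) p.407] -/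
theorem norm_QsaQCubeY_mul_sub_apply_le_of_forall (hb₀ : 0 < b₀) {U V : CfgY 𝔸 i} (hU : ∀ μ x, UnitaryLike (U μ x)) (hV : ∀ μ x, UnitaryLike (V μ x))
    {ρ : ℝ} (hρ : 0 ≤ ρ) (hsmall : ∀ (ν : Fin (d + 1)) (w : Site (PV d ℓ i.m i.K hd hL) 0), ‖(V ν w : 𝔸) - 1‖ ≤ ρ)
    (A : FBondY i → 𝔸) {P : ℝ} (hP : 0 ≤ P) (hA : ∀ (ι : IBondCubeY i q) (f : FBondY i), qKc i q ι f ≠ 0 → wCubeBond i q ι * ‖A f‖ ≤ P) (b : FBondY i) :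
    ‖(QsCubeY i q (parBY i) (fun μ x => V μ x * U μ x) (aCubeY i q (QCubeY i q (parBY i) (fun μ x => V μ x * U μ x) A)) -
        QsCubeY i q (parBY i) U (aCubeY i q (QCubeY i q (parBY i) U A))) b‖ ≤
      8 * (((d + 2) * ((ℓ + 1) ^ i.k - 1) : ℕ) : ℝ) * ρ * (1 + (((d + 2) * ((ℓ + 1) ^ i.k - 1) : ℕ) : ℝ) * ρ) * P :=
  norm_QsaQCubeY_mul_sub_apply_le' i q hb₀ hU hV hρ b (fun _ _ ν w _ => hsmall ν w) A hP (fun ι f _ hf => hA ι f hf)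

/-- ★★ **(3.83) ON THE CUBE ROAD** (background gauged to `1`, Cor. 3.6 p. 408; `U′` (3.37)-small everywhere): `‖(Q*_□(U′)a_□Q_□(U′)A − Q*_□(1)a_□Q_□(1)A)(b)‖ ≤
8Dρ(1 + Dρ)·P`. [cite: Balaban1985BackgroundPropagators, (3.83) p.407, Cor. 3.5 p.407, Cor. 3.6 p.408] -/
theorem norm_QsaQCubeY_sub_one_apply_le_of_forall (hb₀ : 0 < b₀) {V : CfgY 𝔸 i} (hV : ∀ μ x, UnitaryLike (V μ x))
    {ρ : ℝ} (hρ : 0 ≤ ρ) (hsmall : ∀ (ν : Fin (d + 1)) (w : Site (PV d ℓ i.m i.K hd hL) 0), ‖(V ν w : 𝔸) - 1‖ ≤ ρ)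
    (A : FBondY i → 𝔸) {P : ℝ} (hP : 0 ≤ P) (hA : ∀ (ι : IBondCubeY i q) (f : FBondY i), qKc i q ι f ≠ 0 → wCubeBond i q ι * ‖A f‖ ≤ P) (b : FBondY i) :
    ‖(QsCubeY i q (parBY i) V (aCubeY i q (QCubeY i q (parBY i) V A)) - QsCubeY i q (parBY i) 1 (aCubeY i q (QCubeY i q (parBY i) 1 A))) b‖ ≤
      8 * (((d + 2) * ((ℓ + 1) ^ i.k - 1) : ℕ) : ℝ) * ρ * (1 + (((d + 2) * ((ℓ + 1) ^ i.k - 1) : ℕ) : ℝ) * ρ) * P := by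
  have h := norm_QsaQCubeY_mul_sub_apply_le_of_forall i q hb₀ (U := 1) (fun _ _ => T4RelativeLadder.UnitaryLike.one) hV hρ hsmall A hP hA b
  rwa [mul_one_cfg] at h

end Pointwise

/-! ## §4 THE `L²` FACE: Schur's test for the cube letters in the weight-one trace norm (the `(a, b) = (a_P, 0)` operator bound of p02's (ii)) -/

section L2

open scoped Matrix.Norms.L2Operator

open Literature.MathematicalPhysics.QuantumFieldTheory.Balaban1983to89.B6KLevelCensusIndexV1 (KIdx)
open Literature.MathematicalPhysics.QuantumFieldTheory.Balaban1983to89.B6Cover236MultiLevelBlocks (cubes)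
open Literature.MathematicalPhysics.QuantumFieldTheory.Balaban1983to89.B6GlobalChartV1 (PV)
open Literature.MathematicalPhysics.QuantumFieldTheory.Balaban1983to89.B15DeterminingSets (embIter)
open Literature.MathematicalPhysics.QuantumFieldTheory.Balaban1983to89.B3TorusRadialSums (supDist_le_tdist)
open Literature.MathematicalPhysics.QuantumFieldTheory.Balaban1983to89.B9CubeLettersBondOpsL0 (IBondCubeY qKc qsKc qTc aCubeY QCubeY QsCubeY)
open Literature.MathematicalPhysics.QuantumFieldTheory.Balaban1983to89.B9CubeBondWeights (wCubeBond wCubeBond_pos)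
open Literature.MathematicalPhysics.QuantumFieldTheory.Balaban1983to89.B9CubeLettersCovarianceL0 (qsKc_eq_transpose)
open Literature.MathematicalPhysics.QuantumFieldTheory.Balaban1983to89.B9Eq380CubeLetters (unitaryLike_qTc_parBY norm_qTc_mul_sub_le tdist_of_qKc_ne_zero_le mul_one_cfg)

variable {d ℓ : ℕ} {hd : 1 ≤ d + 1} {hL : Odd (ℓ + 1) ∧ 1 < ℓ + 1} {b₀ b₁ : ℝ} {N : ℕ} [Nonempty (Fin N)]
variable (i : KIdx d ℓ hd hL b₀ b₁) (q : ↥(cubes (toKT i).D.toDomains))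

/-- fibrewise: `‖(Q_□(U)C)(ι)‖_F ≤ Σ_f q_□(ι,f)·‖C(f)‖_F` (unitary-like `U`). [cite: Balaban1985BackgroundPropagators, (3.12)–(3.14) pp.392–393, (3.28) p.395, p.409 l.3–5] -/
theorem fro_QCubeY_apply_le {U : CfgY (Matrix (Fin N) (Fin N) ℂ) i} (hU : ∀ μ x, UnitaryLike (U μ x))
    (C : FBondY i → Matrix (Fin N) (Fin N) ℂ) (ι : IBondCubeY i q) :
    fro (QCubeY i q (parBY i) U C ι) ≤ ∑ f, qKc i q ι f * fro (C f) := by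
  refine (fro_trLiftY_apply_le (qKc i q) (T := qTc i q (parBY i) U) C ι (fun f _ => unitaryLike_qTc_parBY i q hU ι f)).trans (le_of_eq ?_)
  exact Finset.sum_congr rfl fun f _ => by rw [abs_of_nonneg (qKc_nonneg i q ι f)]

/-- fibrewise: `‖(Q*_□(U)X)(b)‖_F ≤ Σ_ι q_□(ι,b)·‖X(ι)‖_F` (the kernel of `Q*_□` is the transpose; transporters inverted). [cite: Balaban1985BackgroundPropagators, (3.13) p.392, p.409 l.3–5] -/
theorem fro_QsCubeY_apply_le {U : CfgY (Matrix (Fin N) (Fin N) ℂ) i} (hU : ∀ μ x, UnitaryLike (U μ x))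
    (X : IBondCubeY i q → Matrix (Fin N) (Fin N) ℂ) (b : FBondY i) :
    fro (QsCubeY i q (parBY i) U X b) ≤ ∑ ι, qKc i q ι b * fro (X ι) := by
  refine (fro_trLiftY_apply_le (qsKc i q) (T := fun b ι => (qTc i q (parBY i) U ι b)⁻¹) X b
    (fun ι _ => (unitaryLike_qTc_parBY i q hU ι b).inv)).trans (le_of_eq ?_)
  exact Finset.sum_congr rfl fun ι _ => by rw [qsKc_eq_transpose, Matrix.transpose_apply, abs_of_nonneg (qKc_nonneg i q ι b)]

/-- (GENERAL AVERAGING RANGE `Da` — any bound `q_□(ι,b) ≠ 0 ⟹ |embIter j(ι) ι₋ − b₋|₁ ≤ Da`, e.g. the level-sharp one of the cube at hand) fibrewise (3.81) in Frobenius size: `‖(F₂C)(ι)‖_F ≤ 2Dρ·Σ_f q_□(ι,f)‖C(f)‖_F`, `F₂ = Q_□(U′U) − Q_□(U)`, `D = (d+2)(Lᵏ − 1)`, under the smallness of `U′ − 1` within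
`ℓ^∞`-distance `D` of the base point of `ι`. [cite: Balaban1985BackgroundPropagators, (3.80)–(3.81) pp.406–407, p.409 l.3–5] -/
theorem fro_F2_apply_le_ofRange {U V : CfgY (Matrix (Fin N) (Fin N) ℂ) i} (hU : ∀ μ x, UnitaryLike (U μ x)) (hV : ∀ μ x, UnitaryLike (V μ x))
    {ρ : ℝ} (hρ : 0 ≤ ρ)
    {Da : ℕ} (hDa : ∀ (ι : IBondCubeY i q) (b : FBondY i), qKc i q ι b ≠ 0 → Site.tdist (embIter (ι.1.1 : ℕ) ι.1.2.src) b.src ≤ Da) (ι : IBondCubeY i q)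
    (hsmall : ∀ (ν : Fin (d + 1)) (w : Site (PV d ℓ i.m i.K hd hL) 0),
      supDist (embIter (ι.1.1 : ℕ) ι.1.2.src) w ≤ Da → ‖(V ν w : Matrix (Fin N) (Fin N) ℂ) - 1‖ ≤ ρ)
    (C : FBondY i → Matrix (Fin N) (Fin N) ℂ) :
    fro ((QCubeY i q (parBY i) (fun μ x => V μ x * U μ x) C - QCubeY i q (parBY i) U C) ι) ≤
      2 * (Da : ℝ) * ρ * ∑ f, qKc i q ι f * fro (C f) := by
  have hVU : ∀ μ x, UnitaryLike (V μ x * U μ x) := fun μ x => (hV μ x).mul (hU μ x)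
  have h := fro_trLiftY_sub_apply_le (qKc i q) (qTc i q (parBY i) (fun μ x => V μ x * U μ x)) (qTc i q (parBY i) U) C ι
    (τ := fun _ => (Da : ℝ) * ρ)
    (fun f _ => unitaryLike_qTc_parBY i q hVU ι f) (fun f _ => unitaryLike_qTc_parBY i q hU ι f)
    (fun f hf => by
      have hD := hDa ι f hf
      refine (norm_qTc_mul_sub_le i q hU hV hρ ι f fun ν w hw => hsmall ν w ?_).trans ?_
      · exact hw.trans ((supDist_le_tdist _ _).trans hD)
      · exact mul_le_mul_of_nonneg_right (by exact_mod_cast hD) hρ)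
  refine h.trans (le_of_eq ?_)
  rw [Finset.mul_sum]
  exact Finset.sum_congr rfl fun f _ => by rw [abs_of_nonneg (qKc_nonneg i q ι f)]; ring

/-- (THE RANGE DISCHARGED UNIFORMLY: `Da = (d+2)(Lᵏ − 1)`, `B9Eq380CubeLetters.tdist_of_qKc_ne_zero_le`) fibrewise (3.81) in Frobenius size: `‖(F₂C)(ι)‖_F ≤ 2Dρ·Σ_f q_□(ι,f)‖C(f)‖_F`, `F₂ = Q_□(U′U) − Q_□(U)`, `D = (d+2)(Lᵏ − 1)`, under the smallness of `U′ − 1` within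
`ℓ^∞`-distance `D` of the base point of `ι`. [cite: Balaban1985BackgroundPropagators, (3.80)–(3.81) pp.406–407, p.409 l.3–5] -/
theorem fro_F2_apply_le {U V : CfgY (Matrix (Fin N) (Fin N) ℂ) i} (hU : ∀ μ x, UnitaryLike (U μ x)) (hV : ∀ μ x, UnitaryLike (V μ x))
    {ρ : ℝ} (hρ : 0 ≤ ρ) (ι : IBondCubeY i q)
    (hsmall : ∀ (ν : Fin (d + 1)) (w : Site (PV d ℓ i.m i.K hd hL) 0),
      supDist (embIter (ι.1.1 : ℕ) ι.1.2.src) w ≤ (d + 2) * ((ℓ + 1) ^ i.k - 1) → ‖(V ν w : Matrix (Fin N) (Fin N) ℂ) - 1‖ ≤ ρ)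
    (C : FBondY i → Matrix (Fin N) (Fin N) ℂ) :
    fro ((QCubeY i q (parBY i) (fun μ x => V μ x * U μ x) C - QCubeY i q (parBY i) U C) ι) ≤
      2 * (((d + 2) * ((ℓ + 1) ^ i.k - 1) : ℕ) : ℝ) * ρ * ∑ f, qKc i q ι f * fro (C f) :=
  fro_F2_apply_le_ofRange i q hU hV hρ (tdist_of_qKc_ne_zero_le i q) ι hsmall C

/-- (GENERAL AVERAGING RANGE `Da` — any bound `q_□(ι,b) ≠ 0 ⟹ |embIter j(ι) ι₋ − b₋|₁ ≤ Da`, e.g. the level-sharp one of the cube at hand) fibrewise (3.81) for `F₂* = Q*_□(U′U) − Q*_□(U)` in Frobenius size: `‖(F₂*X)(b)‖_F ≤ 2Dρ·Σ_ι q_□(ι,b)‖X(ι)‖_F`, under the smallness around the base point of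
every index bond of the cube sequence. [cite: Balaban1985BackgroundPropagators, (3.80)–(3.81) pp.406–407, p.407 l.1–3, p.409 l.3–5] -/
theorem fro_F2s_apply_le_ofRange {U V : CfgY (Matrix (Fin N) (Fin N) ℂ) i} (hU : ∀ μ x, UnitaryLike (U μ x)) (hV : ∀ μ x, UnitaryLike (V μ x))
    {ρ : ℝ} (hρ : 0 ≤ ρ)
    {Da : ℕ} (hDa : ∀ (ι : IBondCubeY i q) (b : FBondY i), qKc i q ι b ≠ 0 → Site.tdist (embIter (ι.1.1 : ℕ) ι.1.2.src) b.src ≤ Da)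
    (hsmall : ∀ (ι : IBondCubeY i q) (ν : Fin (d + 1)) (w : Site (PV d ℓ i.m i.K hd hL) 0),
      supDist (embIter (ι.1.1 : ℕ) ι.1.2.src) w ≤ Da → ‖(V ν w : Matrix (Fin N) (Fin N) ℂ) - 1‖ ≤ ρ)
    (X : IBondCubeY i q → Matrix (Fin N) (Fin N) ℂ) (b : FBondY i) :
    fro ((QsCubeY i q (parBY i) (fun μ x => V μ x * U μ x) X - QsCubeY i q (parBY i) U X) b) ≤
      2 * (Da : ℝ) * ρ * ∑ ι, qKc i q ι b * fro (X ι) := by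
  have hVU : ∀ μ x, UnitaryLike (V μ x * U μ x) := fun μ x => (hV μ x).mul (hU μ x)
  have h := fro_trLiftY_sub_apply_le (qsKc i q) (fun b ι => (qTc i q (parBY i) (fun μ x => V μ x * U μ x) ι b)⁻¹)
    (fun b ι => (qTc i q (parBY i) U ι b)⁻¹) X b (τ := fun _ => (Da : ℝ) * ρ)
    (fun ι _ => (unitaryLike_qTc_parBY i q hVU ι b).inv) (fun ι _ => (unitaryLike_qTc_parBY i q hU ι b).inv)
    (fun ι hι => by
      have hι' : qKc i q ι b ≠ 0 := by rwa [qsKc_eq_transpose, Matrix.transpose_apply] at hι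
      have hD := hDa ι b hι'
      refine (norm_inv_sub_inv_le (unitaryLike_qTc_parBY i q hVU ι b) (unitaryLike_qTc_parBY i q hU ι b)).trans ?_
      refine (norm_qTc_mul_sub_le i q hU hV hρ ι b fun ν w hw => hsmall ι ν w ?_).trans ?_
      · exact hw.trans ((supDist_le_tdist _ _).trans hD)
      · exact mul_le_mul_of_nonneg_right (by exact_mod_cast hD) hρ)
  refine h.trans (le_of_eq ?_)
  rw [Finset.mul_sum]
  exact Finset.sum_congr rfl fun ι _ => by rw [qsKc_eq_transpose, Matrix.transpose_apply, abs_of_nonneg (qKc_nonneg i q ι b)]; ring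

/-- (THE RANGE DISCHARGED UNIFORMLY: `Da = (d+2)(Lᵏ − 1)`, `B9Eq380CubeLetters.tdist_of_qKc_ne_zero_le`) fibrewise (3.81) for `F₂* = Q*_□(U′U) − Q*_□(U)` in Frobenius size: `‖(F₂*X)(b)‖_F ≤ 2Dρ·Σ_ι q_□(ι,b)‖X(ι)‖_F`, under the smallness around the base point of
every index bond of the cube sequence. [cite: Balaban1985BackgroundPropagators, (3.80)–(3.81) pp.406–407, p.407 l.1–3, p.409 l.3–5] -/
theorem fro_F2s_apply_le {U V : CfgY (Matrix (Fin N) (Fin N) ℂ) i} (hU : ∀ μ x, UnitaryLike (U μ x)) (hV : ∀ μ x, UnitaryLike (V μ x))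
    {ρ : ℝ} (hρ : 0 ≤ ρ)
    (hsmall : ∀ (ι : IBondCubeY i q) (ν : Fin (d + 1)) (w : Site (PV d ℓ i.m i.K hd hL) 0),
      supDist (embIter (ι.1.1 : ℕ) ι.1.2.src) w ≤ (d + 2) * ((ℓ + 1) ^ i.k - 1) → ‖(V ν w : Matrix (Fin N) (Fin N) ℂ) - 1‖ ≤ ρ)
    (X : IBondCubeY i q → Matrix (Fin N) (Fin N) ℂ) (b : FBondY i) :
    fro ((QsCubeY i q (parBY i) (fun μ x => V μ x * U μ x) X - QsCubeY i q (parBY i) U X) b) ≤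
      2 * (((d + 2) * ((ℓ + 1) ^ i.k - 1) : ℕ) : ℝ) * ρ * ∑ ι, qKc i q ι b * fro (X ι) :=
  fro_F2s_apply_le_ofRange i q hU hV hρ (tdist_of_qKc_ne_zero_le i q) hsmall X b

omit [Nonempty (Fin N)] in
/-- fibrewise: `‖(a_□X)(ι)‖_F = w_□(ι)·‖X(ι)‖_F`. [cite: Balaban1985BackgroundPropagators, (3.26) p.395, bookkeeping] -/
theorem fro_aCubeY_apply (hb₀ : 0 < b₀) (X : IBondCubeY i q → Matrix (Fin N) (Fin N) ℂ) (ι : IBondCubeY i q) :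
    fro (aCubeY i q X ι) = wCubeBond i q ι * fro (X ι) := by
  rw [aCubeY_apply, fro_smul_complex, Complex.norm_real, Real.norm_eq_abs, abs_of_pos (wCubeBond_pos i q hb₀ ι)]

/-- (GENERAL AVERAGING RANGE `Da` — any bound `q_□(ι,b) ≠ 0 ⟹ |embIter j(ι) ι₋ − b₋|₁ ≤ Da`, e.g. the level-sharp one of the cube at hand) ★★ **THE KERNEL DOMINATION OF `P₂` ON FINE BONDS**: with `c₀ = 4Dρ(1 + Dρ)`,
`‖(P₂C)(b)‖_F ≤ Σ_f [c₀·Σ_ι q_□(ι,b)·w_□(ι)·q_□(ι,f)]·‖C(f)‖_F` — the three terms of (3.82) dominated by the SYMMETRIC semi-local kernel `Q_□ᵀ·a_□·Q_□`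
(print's «semi-local operator … blocks neighbouring the block containing the bond b»). [cite: Balaban1985BackgroundPropagators, (3.82)–(3.83) p.407, (3.26) p.395, p.409 l.1–5] -/
theorem fro_QsaQCubeY_mul_sub_apply_le_ofRange (hb₀ : 0 < b₀) {U V : CfgY (Matrix (Fin N) (Fin N) ℂ) i} (hU : ∀ μ x, UnitaryLike (U μ x))
    (hV : ∀ μ x, UnitaryLike (V μ x)) {ρ : ℝ} (hρ : 0 ≤ ρ)
    {Da : ℕ} (hDa : ∀ (ι : IBondCubeY i q) (b : FBondY i), qKc i q ι b ≠ 0 → Site.tdist (embIter (ι.1.1 : ℕ) ι.1.2.src) b.src ≤ Da)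
    (hsmall : ∀ (ι : IBondCubeY i q) (ν : Fin (d + 1)) (w : Site (PV d ℓ i.m i.K hd hL) 0),
      supDist (embIter (ι.1.1 : ℕ) ι.1.2.src) w ≤ Da → ‖(V ν w : Matrix (Fin N) (Fin N) ℂ) - 1‖ ≤ ρ)
    (C : FBondY i → Matrix (Fin N) (Fin N) ℂ) (b : FBondY i) :
    fro ((QsCubeY i q (parBY i) (fun μ x => V μ x * U μ x) ∘ₗ aCubeY i q ∘ₗ QCubeY i q (parBY i) (fun μ x => V μ x * U μ x) -
        QsCubeY i q (parBY i) U ∘ₗ aCubeY i q ∘ₗ QCubeY i q (parBY i) U) C b) ≤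
      ∑ f, (4 * (Da : ℝ) * ρ * (1 + (Da : ℝ) * ρ) *
        ∑ ι, qKc i q ι b * wCubeBond i q ι * qKc i q ι f) * fro (C f) := by
  set D : ℝ := (Da : ℝ) with hDdef
  have hD0 : 0 ≤ D := by rw [hDdef]; positivity
  set X₀ : IBondCubeY i q → Matrix (Fin N) (Fin N) ℂ := aCubeY i q (QCubeY i q (parBY i) U C) with hX₀
  set X₁ : IBondCubeY i q → Matrix (Fin N) (Fin N) ℂ := aCubeY i q (QCubeY i q (parBY i) (fun μ x => V μ x * U μ x) C) with hX₁
  -- the row profile `m ι := w_□(ι)·Σ_f q_□(ι,f)‖C f‖_F` controls `X₀` and `X₁ − X₀`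
  have hw0 : ∀ ι, 0 ≤ wCubeBond i q ι := fun ι => (wCubeBond_pos i q hb₀ ι).le
  have hX0 : ∀ ι, fro (X₀ ι) ≤ wCubeBond i q ι * ∑ f, qKc i q ι f * fro (C f) := by
    intro ι
    rw [hX₀, fro_aCubeY_apply i q hb₀]
    exact mul_le_mul_of_nonneg_left (fro_QCubeY_apply_le i q hU C ι) (hw0 ι)
  have hX10 : X₁ - X₀ = aCubeY i q (QCubeY i q (parBY i) (fun μ x => V μ x * U μ x) C - QCubeY i q (parBY i) U C) := by
    rw [hX₁, hX₀, map_sub]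
  have hX1 : ∀ ι, fro ((X₁ - X₀) ι) ≤ 2 * D * ρ * (wCubeBond i q ι * ∑ f, qKc i q ι f * fro (C f)) := by
    intro ι
    rw [hX10, fro_aCubeY_apply i q hb₀]
    calc wCubeBond i q ι * fro ((QCubeY i q (parBY i) (fun μ x => V μ x * U μ x) C - QCubeY i q (parBY i) U C) ι)
        ≤ wCubeBond i q ι * (2 * D * ρ * ∑ f, qKc i q ι f * fro (C f)) :=
          mul_le_mul_of_nonneg_left (fro_F2_apply_le_ofRange i q hU hV hρ hDa ι (hsmall ι) C) (hw0 ι)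
      _ = _ := by ring
  -- the three terms of (3.82), fibrewise at `b`
  have hsplit := apply_sub_apply_eq_three_terms (QsCubeY i q (parBY i) U) (QsCubeY i q (parBY i) (fun μ x => V μ x * U μ x)) X₀ X₁
  have happ := congrArg (fun g : FBondY i → Matrix (Fin N) (Fin N) ℂ => g b) hsplit
  simp only [Pi.add_apply, Pi.sub_apply] at happ
  have hLHS : (QsCubeY i q (parBY i) (fun μ x => V μ x * U μ x) ∘ₗ aCubeY i q ∘ₗ QCubeY i q (parBY i) (fun μ x => V μ x * U μ x) -
        QsCubeY i q (parBY i) U ∘ₗ aCubeY i q ∘ₗ QCubeY i q (parBY i) U) C b =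
      QsCubeY i q (parBY i) (fun μ x => V μ x * U μ x) X₁ b - QsCubeY i q (parBY i) U X₀ b := by
    rw [LinearMap.sub_apply, Pi.sub_apply]; rfl
  rw [hLHS, happ]
  -- term bounds against the common profile `Σ_ι q_□(ι,b)·m ι`
  have hT1 : fro (QsCubeY i q (parBY i) (fun μ x => V μ x * U μ x) X₀ b - QsCubeY i q (parBY i) U X₀ b) ≤
      2 * D * ρ * ∑ ι, qKc i q ι b * (wCubeBond i q ι * ∑ f, qKc i q ι f * fro (C f)) := by
    have e := fro_F2s_apply_le_ofRange i q hU hV hρ hDa hsmall X₀ b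
    rw [Pi.sub_apply] at e
    refine e.trans (mul_le_mul_of_nonneg_left (Finset.sum_le_sum fun ι _ => ?_) (by positivity))
    exact mul_le_mul_of_nonneg_left (hX0 ι) (qKc_nonneg i q ι b)
  have hT2 : fro (QsCubeY i q (parBY i) U (X₁ - X₀) b) ≤ 2 * D * ρ * ∑ ι, qKc i q ι b * (wCubeBond i q ι * ∑ f, qKc i q ι f * fro (C f)) := by
    refine (fro_QsCubeY_apply_le i q hU (X₁ - X₀) b).trans ?_
    rw [Finset.mul_sum]
    refine Finset.sum_le_sum fun ι _ => ?_
    calc qKc i q ι b * fro ((X₁ - X₀) ι) ≤ qKc i q ι b * (2 * D * ρ * (wCubeBond i q ι * ∑ f, qKc i q ι f * fro (C f))) :=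
          mul_le_mul_of_nonneg_left (hX1 ι) (qKc_nonneg i q ι b)
      _ = _ := by ring
  have hT3 : fro (QsCubeY i q (parBY i) (fun μ x => V μ x * U μ x) (X₁ - X₀) b - QsCubeY i q (parBY i) U (X₁ - X₀) b) ≤
      2 * D * ρ * (2 * D * ρ * ∑ ι, qKc i q ι b * (wCubeBond i q ι * ∑ f, qKc i q ι f * fro (C f))) := by
    have e := fro_F2s_apply_le_ofRange i q hU hV hρ hDa hsmall (X₁ - X₀) b
    rw [Pi.sub_apply] at e
    refine e.trans (mul_le_mul_of_nonneg_left ?_ (by positivity))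
    rw [Finset.mul_sum]
    refine Finset.sum_le_sum fun ι _ => ?_
    calc qKc i q ι b * fro ((X₁ - X₀) ι) ≤ qKc i q ι b * (2 * D * ρ * (wCubeBond i q ι * ∑ f, qKc i q ι f * fro (C f))) :=
          mul_le_mul_of_nonneg_left (hX1 ι) (qKc_nonneg i q ι b)
      _ = _ := by ring
  -- assemble and exchange the sums
  have hswap : ∑ ι, qKc i q ι b * (wCubeBond i q ι * ∑ f, qKc i q ι f * fro (C f)) =
      ∑ f, (∑ ι, qKc i q ι b * wCubeBond i q ι * qKc i q ι f) * fro (C f) := by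
    have : ∀ ι, qKc i q ι b * (wCubeBond i q ι * ∑ f, qKc i q ι f * fro (C f)) = ∑ f, qKc i q ι b * wCubeBond i q ι * qKc i q ι f * fro (C f) := by
      intro ι; rw [Finset.mul_sum, Finset.mul_sum]; exact Finset.sum_congr rfl fun f _ => by ring
    rw [Finset.sum_congr rfl fun ι _ => this ι, Finset.sum_comm]
    exact Finset.sum_congr rfl fun f _ => by rw [Finset.sum_mul]
  calc fro (QsCubeY i q (parBY i) (fun μ x => V μ x * U μ x) X₀ b - QsCubeY i q (parBY i) U X₀ b + QsCubeY i q (parBY i) U (X₁ - X₀) b +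
          (QsCubeY i q (parBY i) (fun μ x => V μ x * U μ x) (X₁ - X₀) b - QsCubeY i q (parBY i) U (X₁ - X₀) b))
      ≤ fro (QsCubeY i q (parBY i) (fun μ x => V μ x * U μ x) X₀ b - QsCubeY i q (parBY i) U X₀ b) + fro (QsCubeY i q (parBY i) U (X₁ - X₀) b) +
          fro (QsCubeY i q (parBY i) (fun μ x => V μ x * U μ x) (X₁ - X₀) b - QsCubeY i q (parBY i) U (X₁ - X₀) b) :=
        (fro_add_le _ _).trans (add_le_add (fro_add_le _ _) le_rfl)
    _ ≤ 2 * D * ρ * ∑ ι, qKc i q ι b * (wCubeBond i q ι * ∑ f, qKc i q ι f * fro (C f)) +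
          2 * D * ρ * ∑ ι, qKc i q ι b * (wCubeBond i q ι * ∑ f, qKc i q ι f * fro (C f)) +
          2 * D * ρ * (2 * D * ρ * ∑ ι, qKc i q ι b * (wCubeBond i q ι * ∑ f, qKc i q ι f * fro (C f))) := add_le_add (add_le_add hT1 hT2) hT3
    _ = (4 * D * ρ * (1 + D * ρ)) * ∑ ι, qKc i q ι b * (wCubeBond i q ι * ∑ f, qKc i q ι f * fro (C f)) := by ring
    _ = ∑ f, (4 * D * ρ * (1 + D * ρ) * ∑ ι, qKc i q ι b * wCubeBond i q ι * qKc i q ι f) * fro (C f) := by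
        rw [hswap, Finset.mul_sum]; exact Finset.sum_congr rfl fun f _ => by ring

/-- (THE RANGE DISCHARGED UNIFORMLY: `Da = (d+2)(Lᵏ − 1)`, `B9Eq380CubeLetters.tdist_of_qKc_ne_zero_le`) ★★ **THE KERNEL DOMINATION OF `P₂` ON FINE BONDS**: with `c₀ = 4Dρ(1 + Dρ)`,
`‖(P₂C)(b)‖_F ≤ Σ_f [c₀·Σ_ι q_□(ι,b)·w_□(ι)·q_□(ι,f)]·‖C(f)‖_F` — the three terms of (3.82) dominated by the SYMMETRIC semi-local kernel `Q_□ᵀ·a_□·Q_□`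
(print's «semi-local operator … blocks neighbouring the block containing the bond b»). [cite: Balaban1985BackgroundPropagators, (3.82)–(3.83) p.407, (3.26) p.395, p.409 l.1–5] -/
theorem fro_QsaQCubeY_mul_sub_apply_le (hb₀ : 0 < b₀) {U V : CfgY (Matrix (Fin N) (Fin N) ℂ) i} (hU : ∀ μ x, UnitaryLike (U μ x))
    (hV : ∀ μ x, UnitaryLike (V μ x)) {ρ : ℝ} (hρ : 0 ≤ ρ)
    (hsmall : ∀ (ι : IBondCubeY i q) (ν : Fin (d + 1)) (w : Site (PV d ℓ i.m i.K hd hL) 0),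
      supDist (embIter (ι.1.1 : ℕ) ι.1.2.src) w ≤ (d + 2) * ((ℓ + 1) ^ i.k - 1) → ‖(V ν w : Matrix (Fin N) (Fin N) ℂ) - 1‖ ≤ ρ)
    (C : FBondY i → Matrix (Fin N) (Fin N) ℂ) (b : FBondY i) :
    fro ((QsCubeY i q (parBY i) (fun μ x => V μ x * U μ x) ∘ₗ aCubeY i q ∘ₗ QCubeY i q (parBY i) (fun μ x => V μ x * U μ x) -
        QsCubeY i q (parBY i) U ∘ₗ aCubeY i q ∘ₗ QCubeY i q (parBY i) U) C b) ≤
      ∑ f, (4 * (((d + 2) * ((ℓ + 1) ^ i.k - 1) : ℕ) : ℝ) * ρ * (1 + (((d + 2) * ((ℓ + 1) ^ i.k - 1) : ℕ) : ℝ) * ρ) *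
        ∑ ι, qKc i q ι b * wCubeBond i q ι * qKc i q ι f) * fro (C f) :=
  fro_QsaQCubeY_mul_sub_apply_le_ofRange i q hb₀ hU hV hρ (tdist_of_qKc_ne_zero_le i q) hsmall C b

/-- (GENERAL AVERAGING RANGE `Da` — any bound `q_□(ι,b) ≠ 0 ⟹ |embIter j(ι) ι₋ − b₋|₁ ≤ Da`, e.g. the level-sharp one of the cube at hand) ★★★ **(3.83) IN `L²` — THE OPERATOR BOUND OF THE AVERAGING-EXPANSION PIECE**: for unitary-valued `U, U′` with `‖U′(b′) − 1‖ ≤ ρ` within `ℓ^∞`-distance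
`D = (d+2)(Lᵏ − 1)` of the base point of every index bond of the cube sequence (`0 < b₀ ≤ b₁` the band of the weights),
`‖P₂C‖₁ ≤ 8·b₁c_f²·Dρ(1 + Dρ)·‖C‖₁` for every `C` (`‖·‖₁ = √trIP 1`) — Schur's test on the symmetric kernel `c₀·Q_□ᵀa_□Q_□` whose row and column sums are
`≤ c₀·2b₁c_f²` (§2).  The statement is EXACTLY the input `hP` of `B9Eq382CubeLetters.hQ_of_normBound_reversed` (p02's (ii), piece `P₂`) at `parB := parBY i`,
`U₀ := U`, `U′ := U′U`, `aP := 8·b₁c_f²·Dρ(1 + Dρ)`. [cite: Balaban1985BackgroundPropagators, (3.83) p.407, (3.84)–(3.85) p.407, p.409 l.1–5; Balaban1984PropagatorsII, (2.16) p.225] -/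
theorem sqrt_trIP_QsaQCubeY_mul_sub_le_ofRange (hb₀ : 0 < b₀) (hb₁ : b₀ ≤ b₁) {U V : CfgY (Matrix (Fin N) (Fin N) ℂ) i} (hU : ∀ μ x, UnitaryLike (U μ x))
    (hV : ∀ μ x, UnitaryLike (V μ x)) {ρ : ℝ} (hρ : 0 ≤ ρ)
    {Da : ℕ} (hDa : ∀ (ι : IBondCubeY i q) (b : FBondY i), qKc i q ι b ≠ 0 → Site.tdist (embIter (ι.1.1 : ℕ) ι.1.2.src) b.src ≤ Da)
    (hsmall : ∀ (ι : IBondCubeY i q) (ν : Fin (d + 1)) (w : Site (PV d ℓ i.m i.K hd hL) 0),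
      supDist (embIter (ι.1.1 : ℕ) ι.1.2.src) w ≤ Da → ‖(V ν w : Matrix (Fin N) (Fin N) ℂ) - 1‖ ≤ ρ)
    (C : FBondY i → Matrix (Fin N) (Fin N) ℂ) :
    Real.sqrt (trIP (fun _ => (1 : ℝ))
        ((QsCubeY i q (parBY i) (fun μ x => V μ x * U μ x) ∘ₗ aCubeY i q ∘ₗ QCubeY i q (parBY i) (fun μ x => V μ x * U μ x) -
          QsCubeY i q (parBY i) U ∘ₗ aCubeY i q ∘ₗ QCubeY i q (parBY i) U) C)
        ((QsCubeY i q (parBY i) (fun μ x => V μ x * U μ x) ∘ₗ aCubeY i q ∘ₗ QCubeY i q (parBY i) (fun μ x => V μ x * U μ x) -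
          QsCubeY i q (parBY i) U ∘ₗ aCubeY i q ∘ₗ QCubeY i q (parBY i) U) C)) ≤
      (8 * b₁ * i.cf ^ 2 * ((Da : ℝ) * ρ) * (1 + (Da : ℝ) * ρ)) *
        Real.sqrt (trIP (fun _ => (1 : ℝ)) C C) := by
  set D : ℝ := (Da : ℝ) with hDdef
  have hD0 : 0 ≤ D := by rw [hDdef]; positivity
  have hb1 : 0 ≤ b₁ := hb₀.le.trans hb₁
  set c₀ : ℝ := 4 * D * ρ * (1 + D * ρ) with hc₀
  have hc0 : 0 ≤ c₀ := by rw [hc₀]; positivity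
  -- Schur on the kernel `K(b,f) = c₀·Σ_ι q(ι,b) w(ι) q(ι,f)`
  set K : FBondY i → FBondY i → ℝ := fun b f => c₀ * ∑ ι, qKc i q ι b * wCubeBond i q ι * qKc i q ι f with hK
  have hKnn : ∀ b f, 0 ≤ K b f := fun b f =>
    mul_nonneg hc0 (Finset.sum_nonneg fun ι _ => mul_nonneg (mul_nonneg (qKc_nonneg i q ι b) (wCubeBond_pos i q hb₀ ι).le) (qKc_nonneg i q ι f))
  have hrow : ∀ b, ∑ f, K b f ≤ c₀ * (2 * b₁ * i.cf ^ 2) := by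
    intro b
    rw [hK]
    simp only
    rw [← Finset.mul_sum, Finset.sum_comm]
    refine mul_le_mul_of_nonneg_left ?_ hc0
    have : ∀ ι, ∑ f, qKc i q ι b * wCubeBond i q ι * qKc i q ι f = wCubeBond i q ι * qKc i q ι b := by
      intro ι; rw [← Finset.mul_sum, sum_qKc_eq_one, mul_one, mul_comm]
    rw [Finset.sum_congr rfl fun ι _ => this ι]
    exact sum_wCubeBond_mul_qKc_le i q hb₀ hb₁ b
  have hcol : ∀ f, ∑ b, K b f ≤ c₀ * (2 * b₁ * i.cf ^ 2) := by
    intro f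
    rw [hK]
    simp only
    rw [← Finset.mul_sum, Finset.sum_comm]
    refine mul_le_mul_of_nonneg_left ?_ hc0
    have : ∀ ι, ∑ b, qKc i q ι b * wCubeBond i q ι * qKc i q ι f = wCubeBond i q ι * qKc i q ι f := by
      intro ι
      have e : ∀ b, qKc i q ι b * wCubeBond i q ι * qKc i q ι f = qKc i q ι b * (wCubeBond i q ι * qKc i q ι f) := fun b => by ring
      rw [Finset.sum_congr rfl fun b _ => e b, ← Finset.sum_mul, sum_qKc_eq_one, one_mul]
    rw [Finset.sum_congr rfl fun ι _ => this ι]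
    exact sum_wCubeBond_mul_qKc_le i q hb₀ hb₁ f
  have hdom := fun b => fro_QsaQCubeY_mul_sub_apply_le_ofRange i q hb₀ hU hV hρ hDa hsmall C b
  have h := sqrt_trIP_one_le_of_schur K hKnn (by positivity) hrow hcol C _ hdom
  refine h.trans (le_of_eq ?_)
  rw [Real.sqrt_mul_self (by positivity), hc₀]
  ring

/-- (THE RANGE DISCHARGED UNIFORMLY: `Da = (d+2)(Lᵏ − 1)`, `B9Eq380CubeLetters.tdist_of_qKc_ne_zero_le`) ★★★ **(3.83) IN `L²` — THE OPERATOR BOUND OF THE AVERAGING-EXPANSION PIECE**: for unitary-valued `U, U′` with `‖U′(b′) − 1‖ ≤ ρ` within `ℓ^∞`-distance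
`D = (d+2)(Lᵏ − 1)` of the base point of every index bond of the cube sequence (`0 < b₀ ≤ b₁` the band of the weights),
`‖P₂C‖₁ ≤ 8·b₁c_f²·Dρ(1 + Dρ)·‖C‖₁` for every `C` (`‖·‖₁ = √trIP 1`) — Schur's test on the symmetric kernel `c₀·Q_□ᵀa_□Q_□` whose row and column sums are
`≤ c₀·2b₁c_f²` (§2).  The statement is EXACTLY the input `hP` of `B9Eq382CubeLetters.hQ_of_normBound_reversed` (p02's (ii), piece `P₂`) at `parB := parBY i`,
`U₀ := U`, `U′ := U′U`, `aP := 8·b₁c_f²·Dρ(1 + Dρ)`. [cite: Balaban1985BackgroundPropagators, (3.83) p.407, (3.84)–(3.85) p.407, p.409 l.1–5; Balaban1984PropagatorsII, (2.16) p.225] -/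
theorem sqrt_trIP_QsaQCubeY_mul_sub_le (hb₀ : 0 < b₀) (hb₁ : b₀ ≤ b₁) {U V : CfgY (Matrix (Fin N) (Fin N) ℂ) i} (hU : ∀ μ x, UnitaryLike (U μ x))
    (hV : ∀ μ x, UnitaryLike (V μ x)) {ρ : ℝ} (hρ : 0 ≤ ρ)
    (hsmall : ∀ (ι : IBondCubeY i q) (ν : Fin (d + 1)) (w : Site (PV d ℓ i.m i.K hd hL) 0),
      supDist (embIter (ι.1.1 : ℕ) ι.1.2.src) w ≤ (d + 2) * ((ℓ + 1) ^ i.k - 1) → ‖(V ν w : Matrix (Fin N) (Fin N) ℂ) - 1‖ ≤ ρ)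
    (C : FBondY i → Matrix (Fin N) (Fin N) ℂ) :
    Real.sqrt (trIP (fun _ => (1 : ℝ))
        ((QsCubeY i q (parBY i) (fun μ x => V μ x * U μ x) ∘ₗ aCubeY i q ∘ₗ QCubeY i q (parBY i) (fun μ x => V μ x * U μ x) -
          QsCubeY i q (parBY i) U ∘ₗ aCubeY i q ∘ₗ QCubeY i q (parBY i) U) C)
        ((QsCubeY i q (parBY i) (fun μ x => V μ x * U μ x) ∘ₗ aCubeY i q ∘ₗ QCubeY i q (parBY i) (fun μ x => V μ x * U μ x) -
          QsCubeY i q (parBY i) U ∘ₗ aCubeY i q ∘ₗ QCubeY i q (parBY i) U) C)) ≤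
      (8 * b₁ * i.cf ^ 2 * ((((d + 2) * ((ℓ + 1) ^ i.k - 1) : ℕ) : ℝ) * ρ) * (1 + (((d + 2) * ((ℓ + 1) ^ i.k - 1) : ℕ) : ℝ) * ρ)) *
        Real.sqrt (trIP (fun _ => (1 : ℝ)) C C) :=
  sqrt_trIP_QsaQCubeY_mul_sub_le_ofRange i q hb₀ hb₁ hU hV hρ (tdist_of_qKc_ne_zero_le i q) hsmall C

/-- ★★ **(3.83) IN `L²`, GLOBAL-SMALLNESS FORM** (`‖U′(b) − 1‖ ≤ ρ` at every bond). [cite: Balaban1985BackgroundPropagators, (3.83) p.407, (3.84)–(3.85) p.407] -/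
theorem sqrt_trIP_QsaQCubeY_mul_sub_le_of_forall (hb₀ : 0 < b₀) (hb₁ : b₀ ≤ b₁) {U V : CfgY (Matrix (Fin N) (Fin N) ℂ) i}
    (hU : ∀ μ x, UnitaryLike (U μ x)) (hV : ∀ μ x, UnitaryLike (V μ x)) {ρ : ℝ} (hρ : 0 ≤ ρ)
    (hsmall : ∀ (ν : Fin (d + 1)) (w : Site (PV d ℓ i.m i.K hd hL) 0), ‖(V ν w : Matrix (Fin N) (Fin N) ℂ) - 1‖ ≤ ρ)
    (C : FBondY i → Matrix (Fin N) (Fin N) ℂ) :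
    Real.sqrt (trIP (fun _ => (1 : ℝ))
        ((QsCubeY i q (parBY i) (fun μ x => V μ x * U μ x) ∘ₗ aCubeY i q ∘ₗ QCubeY i q (parBY i) (fun μ x => V μ x * U μ x) -
          QsCubeY i q (parBY i) U ∘ₗ aCubeY i q ∘ₗ QCubeY i q (parBY i) U) C)
        ((QsCubeY i q (parBY i) (fun μ x => V μ x * U μ x) ∘ₗ aCubeY i q ∘ₗ QCubeY i q (parBY i) (fun μ x => V μ x * U μ x) -
          QsCubeY i q (parBY i) U ∘ₗ aCubeY i q ∘ₗ QCubeY i q (parBY i) U) C)) ≤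
      (8 * b₁ * i.cf ^ 2 * ((((d + 2) * ((ℓ + 1) ^ i.k - 1) : ℕ) : ℝ) * ρ) * (1 + (((d + 2) * ((ℓ + 1) ^ i.k - 1) : ℕ) : ℝ) * ρ)) *
        Real.sqrt (trIP (fun _ => (1 : ℝ)) C C) :=
  sqrt_trIP_QsaQCubeY_mul_sub_le i q hb₀ hb₁ hU hV hρ (fun _ ν w _ => hsmall ν w) C

/-- ★★ **(3.83) IN `L²` ON THE CUBE ROAD** (background `1`, `U′` small everywhere): the `P₂`-piece size for the pair `(1, U′)` — the instance fed to p02's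
`B9Eq382CubeLetters.hQ_of_normBound_reversed` with `U₀ := 1`. [cite: Balaban1985BackgroundPropagators, (3.83) p.407, Cor. 3.5 p.407, Cor. 3.6 p.408] -/
theorem sqrt_trIP_QsaQCubeY_sub_one_le_of_forall (hb₀ : 0 < b₀) (hb₁ : b₀ ≤ b₁) {V : CfgY (Matrix (Fin N) (Fin N) ℂ) i}
    (hV : ∀ μ x, UnitaryLike (V μ x)) {ρ : ℝ} (hρ : 0 ≤ ρ)
    (hsmall : ∀ (ν : Fin (d + 1)) (w : Site (PV d ℓ i.m i.K hd hL) 0), ‖(V ν w : Matrix (Fin N) (Fin N) ℂ) - 1‖ ≤ ρ)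
    (C : FBondY i → Matrix (Fin N) (Fin N) ℂ) :
    Real.sqrt (trIP (fun _ => (1 : ℝ))
        ((QsCubeY i q (parBY i) V ∘ₗ aCubeY i q ∘ₗ QCubeY i q (parBY i) V -
          QsCubeY i q (parBY i) (1 : CfgY (Matrix (Fin N) (Fin N) ℂ) i) ∘ₗ aCubeY i q ∘ₗ QCubeY i q (parBY i) (1 : CfgY (Matrix (Fin N) (Fin N) ℂ) i)) C)
        ((QsCubeY i q (parBY i) V ∘ₗ aCubeY i q ∘ₗ QCubeY i q (parBY i) V -
          QsCubeY i q (parBY i) (1 : CfgY (Matrix (Fin N) (Fin N) ℂ) i) ∘ₗ aCubeY i q ∘ₗ QCubeY i q (parBY i) (1 : CfgY (Matrix (Fin N) (Fin N) ℂ) i)) C)) ≤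
      (8 * b₁ * i.cf ^ 2 * ((((d + 2) * ((ℓ + 1) ^ i.k - 1) : ℕ) : ℝ) * ρ) * (1 + (((d + 2) * ((ℓ + 1) ^ i.k - 1) : ℕ) : ℝ) * ρ)) *
        Real.sqrt (trIP (fun _ => (1 : ℝ)) C C) := by
  have h := sqrt_trIP_QsaQCubeY_mul_sub_le_of_forall i q hb₀ hb₁ (U := 1) (fun _ _ => T4RelativeLadder.UnitaryLike.one) hV hρ hsmall C
  rwa [mul_one_cfg] at h

/-- ★ **THE `L²` SIZE OF `Q_□(U)`**: `‖Q_□(U)C‖₁ ≤ √2·‖C‖₁` (unit rows, columns `≤ 2`; unitary-valued `U`). [cite: Balaban1985BackgroundPropagators, (3.12)–(3.14) pp.392–393, (3.28) p.395, p.409 l.3–5; Balaban1984PropagatorsI, (1.18) p.20] -/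
theorem sqrt_trIP_QCubeY_le {U : CfgY (Matrix (Fin N) (Fin N) ℂ) i} (hU : ∀ μ x, UnitaryLike (U μ x)) (C : FBondY i → Matrix (Fin N) (Fin N) ℂ) :
    Real.sqrt (trIP (fun _ => (1 : ℝ)) (QCubeY i q (parBY i) U C) (QCubeY i q (parBY i) U C)) ≤ Real.sqrt 2 * Real.sqrt (trIP (fun _ => (1 : ℝ)) C C) := by
  have h := sqrt_trIP_one_le_of_schur (fun ι f => qKc i q ι f) (qKc_nonneg i q) zero_le_one (fun ι => (sum_qKc_eq_one i q ι).le)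
    (sum_qKc_col_le_two i q) C _ (fro_QCubeY_apply_le i q hU C)
  rwa [one_mul] at h

/-- ★ **THE `L²` SIZE OF `Q*_□(U)`**: `‖Q*_□(U)X‖₁ ≤ √2·‖X‖₁`. [cite: Balaban1985BackgroundPropagators, (3.13) p.392, p.409 l.3–5; Balaban1984PropagatorsI, (1.18) p.20] -/
theorem sqrt_trIP_QsCubeY_le {U : CfgY (Matrix (Fin N) (Fin N) ℂ) i} (hU : ∀ μ x, UnitaryLike (U μ x)) (X : IBondCubeY i q → Matrix (Fin N) (Fin N) ℂ) :
    Real.sqrt (trIP (fun _ => (1 : ℝ)) (QsCubeY i q (parBY i) U X) (QsCubeY i q (parBY i) U X)) ≤ Real.sqrt 2 * Real.sqrt (trIP (fun _ => (1 : ℝ)) X X) := by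
  have h := sqrt_trIP_one_le_of_schur (fun b ι => qKc i q ι b) (fun b ι => qKc_nonneg i q ι b) zero_le_two (sum_qKc_col_le_two i q)
    (fun ι => (sum_qKc_eq_one i q ι).le) X _ (fro_QsCubeY_apply_le i q hU X)
  rwa [mul_one] at h

/-- (GENERAL AVERAGING RANGE `Da` — any bound `q_□(ι,b) ≠ 0 ⟹ |embIter j(ι) ι₋ − b₋|₁ ≤ Da`, e.g. the level-sharp one of the cube at hand) ★ **THE `L²` SIZE OF `F₂ = Q_□(U′U) − Q_□(U)`**: `‖F₂C‖₁ ≤ 2Dρ·√2·‖C‖₁` under the smallness around every base point. [cite: Balaban1985BackgroundPropagators, (3.80)–(3.81) pp.406–407] -/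
theorem sqrt_trIP_F2_le_ofRange {U V : CfgY (Matrix (Fin N) (Fin N) ℂ) i} (hU : ∀ μ x, UnitaryLike (U μ x)) (hV : ∀ μ x, UnitaryLike (V μ x))
    {ρ : ℝ} (hρ : 0 ≤ ρ)
    {Da : ℕ} (hDa : ∀ (ι : IBondCubeY i q) (b : FBondY i), qKc i q ι b ≠ 0 → Site.tdist (embIter (ι.1.1 : ℕ) ι.1.2.src) b.src ≤ Da)
    (hsmall : ∀ (ι : IBondCubeY i q) (ν : Fin (d + 1)) (w : Site (PV d ℓ i.m i.K hd hL) 0),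
      supDist (embIter (ι.1.1 : ℕ) ι.1.2.src) w ≤ Da → ‖(V ν w : Matrix (Fin N) (Fin N) ℂ) - 1‖ ≤ ρ)
    (C : FBondY i → Matrix (Fin N) (Fin N) ℂ) :
    Real.sqrt (trIP (fun _ => (1 : ℝ)) ((QCubeY i q (parBY i) (fun μ x => V μ x * U μ x) - QCubeY i q (parBY i) U) C)
        ((QCubeY i q (parBY i) (fun μ x => V μ x * U μ x) - QCubeY i q (parBY i) U) C)) ≤
      (2 * (Da : ℝ) * ρ * Real.sqrt 2) * Real.sqrt (trIP (fun _ => (1 : ℝ)) C C) := by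
  set D : ℝ := (Da : ℝ) with hDdef
  have hD0 : 0 ≤ D := by rw [hDdef]; positivity
  have hdom : ∀ ι, fro ((QCubeY i q (parBY i) (fun μ x => V μ x * U μ x) - QCubeY i q (parBY i) U) C ι) ≤ ∑ f, (2 * D * ρ * qKc i q ι f) * fro (C f) := by
    intro ι
    have e := fro_F2_apply_le_ofRange i q hU hV hρ hDa ι (hsmall ι) C
    rw [LinearMap.sub_apply]
    refine e.trans (le_of_eq ?_)
    rw [Finset.mul_sum]; exact Finset.sum_congr rfl fun f _ => by ring
  have h := sqrt_trIP_one_le_of_schur (fun ι f => 2 * D * ρ * qKc i q ι f) (fun ι f => by have := qKc_nonneg i q ι f; positivity)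
    (r := 2 * D * ρ) (c := 2 * D * ρ * 2) (by positivity)
    (fun ι => by rw [← Finset.mul_sum, sum_qKc_eq_one, mul_one])
    (fun f => by rw [← Finset.mul_sum]; exact mul_le_mul_of_nonneg_left (sum_qKc_col_le_two i q f) (by positivity)) C _ hdom
  refine h.trans (le_of_eq ?_)
  congr 1
  rw [show 2 * D * ρ * (2 * D * ρ * 2) = (2 * D * ρ) * (2 * D * ρ) * 2 by ring, Real.sqrt_mul (mul_self_nonneg _), Real.sqrt_mul_self (by positivity)]

/-- (THE RANGE DISCHARGED UNIFORMLY: `Da = (d+2)(Lᵏ − 1)`, `B9Eq380CubeLetters.tdist_of_qKc_ne_zero_le`) ★ **THE `L²` SIZE OF `F₂ = Q_□(U′U) − Q_□(U)`**: `‖F₂C‖₁ ≤ 2Dρ·√2·‖C‖₁` under the smallness around every base point. [cite: Balaban1985BackgroundPropagators, (3.80)–(3.81) pp.406–407] -/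
theorem sqrt_trIP_F2_le {U V : CfgY (Matrix (Fin N) (Fin N) ℂ) i} (hU : ∀ μ x, UnitaryLike (U μ x)) (hV : ∀ μ x, UnitaryLike (V μ x))
    {ρ : ℝ} (hρ : 0 ≤ ρ)
    (hsmall : ∀ (ι : IBondCubeY i q) (ν : Fin (d + 1)) (w : Site (PV d ℓ i.m i.K hd hL) 0),
      supDist (embIter (ι.1.1 : ℕ) ι.1.2.src) w ≤ (d + 2) * ((ℓ + 1) ^ i.k - 1) → ‖(V ν w : Matrix (Fin N) (Fin N) ℂ) - 1‖ ≤ ρ)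
    (C : FBondY i → Matrix (Fin N) (Fin N) ℂ) :
    Real.sqrt (trIP (fun _ => (1 : ℝ)) ((QCubeY i q (parBY i) (fun μ x => V μ x * U μ x) - QCubeY i q (parBY i) U) C)
        ((QCubeY i q (parBY i) (fun μ x => V μ x * U μ x) - QCubeY i q (parBY i) U) C)) ≤
      (2 * (((d + 2) * ((ℓ + 1) ^ i.k - 1) : ℕ) : ℝ) * ρ * Real.sqrt 2) * Real.sqrt (trIP (fun _ => (1 : ℝ)) C C) :=
  sqrt_trIP_F2_le_ofRange i q hU hV hρ (tdist_of_qKc_ne_zero_le i q) hsmall C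

end L2

end

end Literature.MathematicalPhysics.QuantumFieldTheory.Balaban1983to89.B9Eq383CubeLetters
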